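import Literature.MathematicalPhysics.QuantumFieldTheory.Balaban1983to89.B4Delta112ZeroBox
import Literature.MathematicalPhysics.QuantumFieldTheory.Balaban1983to89.B4Thm19ZeroBoxHolder

/-!
# `Balaban1983to89.B4Delta112ZeroBoxHolder` — B4 p. 573 Theorem (Prop. 2.1 of [1]), the clause (1.11)–(1.12): the
# HÖLDER inequality (1.9) for `δG_k(Ω, Ω₀, 0) = G_k(Ω, 0) − G_k(Ω₀, 0)` «with the additional factor (1.12)», PROVED
# at `A = 0` for NESTED BLOCK-ALIGNED RECTANGULAR PARALLELEPIPEDS `Ω ⊂ Ω₀`, all scales `k ≥ 1`, all `0 ≤ α < 1`,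
# without any restriction on the points `x, x′`

**Source.** T. Bałaban, *Regularity and Decay of Lattice Green's Functions*, Commun. Math. Phys. **89**, 571–597 (1983)
(bib key `Balaban1983RegularityDecay`, «B4» of the 1983–89 series): p. 572 [PDF 2] (1.2)–(1.6), p. 573 [PDF 3] the
difference derivative `∂^η_μ`, the contour `Γ_{x,x′}` and the Theorem (1.9)–(1.12), p. 577 [PDF 7] the Hölder norm
(2.14), p. 579 [PDF 9] the `δG_k` paragraph of the proof and the remark on rectangular parallelepipeds, p. 581 [PDF 11]
the last sentence of Corollary 2.3 (journal page = PDF page + 570; renders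
`b2b-balaban-ref1/pages/1983-cmp89-regularity-decay/1983-cmp89-regularity-decay-p003-x2.png`, `-p007-x2.png`,
`-p009-x2.png`, `-p011-x2.png`, read as images; transcript `HOME/b2b-balaban-b04/transcript-B4.md` ll. 22–32, 126–128,
154).  A new leaf on top of `B4Delta112ZeroBox` (the VALUE and DERIVATIVE clauses (1.10)·(1.12) for `δG_k(Ω, Ω₀, 0)` on
nested boxes: its cutoff `χ` = `chi` with (C1)–(C2), the decomposition `deltaG_decomp`, the source bounds `value_pt` /
`deriv_pt` / `cutf_pt` / `comm_pt`, the distance bookkeeping `key_dist`, the derivative core `core_deriv` and the merge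
`bounds_common` are USED BY NAME) and of `B4Thm19ZeroBoxHolder` (the HÖLDER clause (1.9) at `A = 0` on boxes as the
uniform two-centre weighted row bound `thm19_zero_box_holder_roww` / `_coeff`, with its functional `wsum2` and pairing
`abs_sum_mul_le_of_wsum2`), hence of `B4Thm110ZeroBox` / `B4Thm110ZeroBoxDeriv` (the two clauses of (1.10) at `A = 0` on
boxes, `thm110_zero_box_roww`, `thm110_zero_box_deriv_roww`) and of the nested-box bookkeeping `B4TwoBox120` (`Fits`,
`emb`); it is exactly the item «NOT the Hölder clause (1.9) for `δG_k`» of the HONEST SCOPE (iii) of `B4Delta112ZeroBox`.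
No existing module is touched; nothing of B4 is asserted as a fact.

## WHAT IS PRINTED (verbatim; `≦` of the print written `≤`)

p. 573: «[Of course ∂^η_μ is a difference derivative defined by (∂^η_μA)(x) = η^{−1}(A(x + ηe_μ) − A(x)).]» […] «for an
arbitrary pair of points x, x′ ∈ ηZ^d, let us denote by Γ_{x,x′} a shortest contour connecting these points.» […]
«**Theorem (Proposition 2.1 of [1]).** For α < 1 there exist positive constants δ₀, c₀, R₀ independent of A, k, Ω and
depending on d, M only, c₀ on α also, such that for e sufficiently small and for an arbitrary function f : Ω → R^N, we
have
|x − x′|^{−α} |U(A(Γ_{x,x′}))(D^η_{A,μ}G_k(Ω, A)f)(x′) − (D^η_{A,μ}G_k(Ω, A)f)(x)| ≤ c₀ exp(−δ₀ dist({x, x′}, supp f))‖f‖_∞   (1.9)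
for x, x′ ∈ Ω, and satisfying the condition dist({x, x′}, Ω^c) ≥ R₀. Similarly
|(D^η_{A,μ}G_k(Ω, A)f)(x)|, |(G_k(Ω, A)(x)| ≤ c₀ exp(−δ₀ dist(x, supp f))‖f‖_∞   (1.10)
for x ∈ Ω, dist(x, Ω^c) ≥ R₀. If Ω ⊂ Ω₀, then for δG_k(Ω, Ω₀, A) defined by the equality
δG_k(Ω, Ω₀, A) = G_k(Ω, A) − G_k(Ω₀, A),   (1.11)
we have the inequalities (1.5) and (1.6) (with the same restrictions on x, x′) with the additional factor
exp(−δ₀ dist(supp f, Ω^c) − δ₀ dist(supp f, Ω^c))   (1.12)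
on the right hand sides. For some simple sets Ω, e.g. for rectangular parallelepipeds, the inequalities hold without
any restrictions on the points x, x′, i.e. for all x, x′ ∈ Ω.»  ⟦sic: «|(G_k(Ω, A)(x)|» — `f` missing, read
`|(G_k(Ω, A)f)(x)|`.  ⟦sic: «(1.5) and (1.6)» are the definitions of `P_k(A)` and `G_k(Ω, A)`; (1.9) and (1.10) are
meant.  ⟦sic: in (1.12) the same distance is printed twice (print defect G-B4-01); the proof, p. 579, and Corollary 2.3,
p. 581, give one distance for the evaluation points and one for the source: `exp(−δ₀dist({x, x′}, Ω^c) − δ₀dist(supp f, Ω^c))`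
for (1.9) — the TYPED READING adopted here (D-b04.2).⟧

p. 577: «We will need Hölder norms:
‖f‖_{1,α} = max{sup_x|f(x)|, sup_{x,μ}|(D^η_{A,μ}f)(x)|, sup_{x,x′,μ} |x′ − x|^{−α}|U(A(Γ_{x,x′}))(D^η_{A,μ}f)(x′) − (D^η_{A,μ}f)(x)|},   (2.14)
where the suprema are taken on a domain of the function f.»

p. 579: «To prove the corresponding inequalities for δG_k(Ω, Ω₀, A) = G_k(Ω, A) − G_k(Ω₀, A) with Ω ⊂ Ω₀, we take the
representations (2.13) for both propagators. The terms with ω such that □_{ω_i} are interior cubes of Ω are the same in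
both representations, so they cancel in the difference, and for δG_k we get a representation similar to (2.13) with
the additional restriction that at least one □_{ω_i} intersects the boundary ∂Ω. We estimate the terms of the
representation as above and we get the first inequality in (2.22) with 2^{d+1} instead of 2^d and with the restriction
n ≥ M^{−1} sup_{x₁∈Ω^c}(dist({x, x′}, x₁) + dist(x₁, supp f)) − 3 ≥ (2M)^{−1}(dist({x, x′}, supp f) + dist({x, x′}, Ω^c)
 + dist(supp f, Ω^c)) − 3.
It implies all the inequalities we need. Finally let us notice that if Ω is a rectangular parallelepiped, then all □_j
in the representation (2.13) are cubes and we can apply Lemma 2.2 to all operators in it, so the restriction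
dist({x, x′}, Ω^c) ≥ R₀ is unnecessary. Thus we have proved the theorem, or rather reduced it to Lemmas 2.1, 2.2.»

p. 581 (end of Corollary 2.3): «The same inequalities hold for δG_k(Ω, Ω₀, A) with the additional factor
e^{−δ₀(dist(supp f, Ω^c) + dist(supp f′, Ω^c))}.»

## WHAT THIS FILE CERTIFIES (kernel-checked, zero `sorry`, no hypotheses; the lineage is USED BY NAME, not re-proved)

For every dimension `d + 1`, every `L = ℓ + 1 ≥ 2`, every window `a ∈ [a₋, a₊]` (`a₋ > 0`), `m² ∈ [0, m²₊]` and every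
`α` with `0 ≤ α < 1` there are `δ₀ > 0`, `c₀ > 0` such that for EVERY scale `k ≥ 1` (`η = L^{-k}`, `n = L^k` fine points
per unit length), every `(a, m²)` in the window, every NESTED PAIR OF BLOCK-ALIGNED BOXES `Ω = s + Π_μ[0, M_μ) ⊂ Ω₀ =
Π_μ[0, M₀_μ)` (integer corner `s`, integer sides `M_μ ≥ 1`; `B4TwoBox120.Fits M M₀ s`; fine points `X = Π[0, nM_μ)`,
`X₀ = Π[0, nM₀_μ)`, `x ↦ x + ns` the inclusion `emb`), every `f : X → ℝ` with `|f| ≤ F`, every axis `μ`, all fine points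
`x ≠ x′` of `X` with `x + e_μ, x′ + e_μ ∈ X`, and all reals `D, D_b, D_f` with `D ≤ min(|x − z|_∞, |x′ − z|_∞)` on
`supp f`, `D_b ≤ min(|x + ns − y|_∞, |x′ + ns − y|_∞)` and `D_f ≤ |z + ns − y|_∞` (`z ∈ supp f`) for all fine points `y`
of `X₀` NOT in `X + ns` (i.e. dominated by the fine sup-distances of `{x, x′}`, `supp f` to `Ω₀∖Ω ⊆ Ω^c`):
* `delta112_zero_box_holder` (§5) — **the Hölder clause (1.9) for `δG_k(Ω, Ω₀, 0)` with the factor (1.12)**: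
  `(n/|x′ − x|_∞)^α · |n((δG_k f)(x′ + e_μ) − (δG_k f)(x′)) − n((δG_k f)(x + e_μ) − (δG_k f)(x))|`
  `≤ c₀ · e^{−δ₀D/n} · e^{−δ₀D_b/n − δ₀D_f/n} · F`;
* `delta112_zero_box_holder_coeff` (§5) — the same clause for the operator with the LITERAL coefficient `a` of (1.6)
  ranging over the window (instead of the running `a_k = B1.aSeq a L k`);
* `core_holder` (§4) — the scale-free core estimate behind both: on any nested pair at `n ≥ 2` fine points per unit,
  the five weighted row bounds (values and bond differences of `G = H(□)⁻¹`, bond differences of `G₀ = H(□₀)⁻¹`, and the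
  two-centre Hölder rows of `G` and `G₀`) at rate `δ`, height `c` give the displayed bound with the explicit constant
  `c_H = c·e^{4δ}(150(d+1) + (160(d+1) + 2a₊)c)` and rate `δ/2`, for all `0 ≤ α ≤ 1`; `bounds_common3` /
  `delta112_holder_of_bounds` (§5) merge the three families of row bounds of nodes 6 / 7 / 10 (`δ = min`, `c = max`)
  and feed the core on `Ω` and on `Ω₀`;
* §6: the statements are instantiated at `d + 1 = 4`, `L = 2`, `a ∈ [1/2, 2]`, `m² ∈ [0, 1]`, `α = 1/2`; a genuinely
  nested pair (`Ω = 1 + [0,1)^4 ⊂ [0,3)^4`) inhabits `Fits` with `M_μ ≥ 1`, a genuine quadruple `x = 0`, `x′ = e₁`,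
  `x + e₀`, `x′ + e₀` lies in the fine box `[0,2)^4`, and `D = D_b = D_f = 0` always meets the distance hypotheses, so
  nothing is vacuous.
Here `δG_k(Ω,Ω₀,0)f := G_k(Ω,0)f − (G_k(Ω₀,0)(Ef))∘emb` (`B4Delta112ZeroBox.dG`; `E` = extension by zero),
`G_k(Ω,0) = (B4BoxCov237.boxOpR n a_k m² M)⁻¹`, `G_k(Ω₀,0) = (boxOpR n a_k m² M₀)⁻¹` — the propagator (1.6)/(1.9) at
`A = 0` in values form, exactly the object of `B4Thm110ZeroBox` / `B4Thm110ZeroBoxDeriv` / `B4Thm19ZeroBoxHolder`.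

MECHANISM (§1–§4; a short operator-theoretic route, NOT the print's).  With node 9's decomposition
`δG f = (1 − χ)u − G₀E((1 − χ)f) + G₀E([H(□), χ]u)`, `u = G_k(Ω)f` (`deltaG_decomp`), the doubly differenced quantity
`n((δGf)(x′+e_μ) − (δGf)(x′)) − n((δGf)(x+e_μ) − (δGf)(x))` is estimated as follows.  FAR PAIRS `|x′ − x|_∞ ≥ n`: the
weight `(n/|x′−x|_∞)^α ≤ 1` and the triangle inequality with node 9's derivative bound `core_deriv` at `x` and at `x′`.
NEAR PAIRS `|x′ − x|_∞ < n`: (T1) the cut term `(1 − χ)u` by the discrete product rule — (i) the two-centre Hölder row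
bound of `u` (node 10 on `X`), (ii) the Lipschitz bound `|χ(y′) − χ(y)| ≤ 8(d+1)|y′ − y|_∞/n` (§1 `abs_chi_sub_le`, from
(C1)) times the bond difference of `u` (node 7), (iii) the bond difference of `χ` (C1) times `u(x′) − u(x)`, telescoped
along a lattice path of `|x′ − x|₁ ≤ (d+1)|x′ − x|_∞` bonds each carrying node 7's differenced-row bound re-centred at `x`
(§2 `rowdiff_le`, cost `e^{δ}` since the path stays within `n` of `x`), (iv) the Lipschitz bound of the bond derivative
`|n∂_μχ(y′) − n∂_μχ(y)| ≤ 128(d+1)|y′ − y|_∞/n` (§1 `abs_dchi_sub_le`, from the second differences (C2′)) times `u(x)`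
(node 6); in (ii)–(iv) the gained factor `|x′ − x|_∞/n` cancels the weight: `(n/s)^α·(s/n) ≤ 1` for `1 ≤ s ≤ n`,
`α ≤ 1` (§3 `holderWeight_mul_le_one`); (T2), (T3) the two `G₀` terms by node 10's two-centre Hölder rows on `X₀` at the
embedded points, paired (§3 `abs_sum_mul_le_of_weight2`: `min(|x−y|,|x′−y|) ≥ |x−y| − |x−x′| ≥ |x−y| − n`, cost `e^{δ}`)
with node 9's pointwise source bounds `cutf_pt` ((1−χ)f lives within `2n` of `Ω₀∖Ω`) and `comm_pt` (`[H,χ]u`, from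
(C1)–(C2) and nodes 6/7).  All sources live within fine distance `2n` of `Ω₀∖Ω`, where `key_dist` (the lattice form of
the printed `(2M)^{-1}(dist({x,x′}, supp f) + dist({x,x′}, Ω^c) + dist(supp f, Ω^c)) − 3`) turns the weights into
`e^{3δ}·e^{−(δ/2)(D + D_b + D_f)/n}`; the single-point distances at `x` dominate the two-point minima.

## DICTIONARY (typist's; each line is a reading, not a quotation; everything at `A = 0`, `U ≡ 1`, one component;
the dictionaries of `B4Delta112ZeroBox` (for `Ω ⊂ Ω₀`, `E`, `δG_k`, the distances to `Ω^c`, (1.12)) and of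
`B4Thm19ZeroBoxHolder` (for the left side of (1.9), `x ≠ x′`, `0 ≤ α`) apply verbatim)

* `U(A(Γ_{x,x′}))` of (1.9)/(2.14) at `A = 0` is the identity ((1.2): `U(0) = 1`), so the left side of (1.9) for `δG_k`
  is `|x − x′|^{−α}|(∂^η_μ δG_k f)(x′) − (∂^η_μ δG_k f)(x)|` ↦
  `(n/supNorm (x′ − x))^α · |n·(((δGf) xe′ − (δGf) x′) − ((δGf) xe − (δGf) x))|` for fine points `x, xe, x′, xe′` of `X`
  with `xe.1 = x.1 + Pi.single μ 1`, `xe'.1 = x'.1 + Pi.single μ 1` (`η^{-1} = n = L^k`; `|x − x′| = η·supNorm`; both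
  bonds in `Ω`, «bonds b ⊂ Ω» of (1.3)); `x ≠ x′` ↦ the binder `x'.1 ≠ x.1`.
* `Ω ⊂ Ω₀` nested block-aligned boxes ↦ `Fits M M₀ s`; `δG_k(Ω, Ω₀, 0)f ↦ dG n a_k m² hs f = (H(□)⁻¹f) − (H(□₀)⁻¹(Ef))∘emb`.
* `dist({x, x′}, supp f)`, `dist({x, x′}, Ω^c)`, `dist(supp f, Ω^c)` ↦ any reals `D/n`, `D_b/n`, `D_f/n` below the fine
  sup-distances `min(|x − supp f|_∞, |x′ − supp f|_∞)`, `min(|x + ns − (X₀∖(X+ns))|_∞, |x′ + ns − (X₀∖(X+ns))|_∞)`,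
  `|supp f + ns − (X₀∖(X+ns))|_∞` (unit = `n` fine sites); since `Ω₀∖Ω ⊆ Ω^c` the printed distances to `Ω^c` are
  admissible values of `D_b/n`, `D_f/n` (the certified bound is the printed one or stronger; when `Ω = Ω₀` the set is
  empty, `D_b`, `D_f` are free and `δG = 0`).
* «additional factor (1.12)» ↦ `e^{−δ₀D_b/n − δ₀D_f/n}` multiplying the (1.9) bound `c₀e^{−δ₀D/n}‖f‖_∞` (`‖f‖_∞ ↦ F ≥ |f|`
  pointwise); «without any restrictions on the points x, x′» ↦ every pair of bonds `⟨x, x + ηe_μ⟩, ⟨x′, x′ + ηe_μ⟩ ⊂ Ω`,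
  `x ≠ x′`.
* «constants δ₀, c₀ independent of A, k, Ω […] c₀ on α also» ↦ `∀ α, 0 ≤ α → α < 1 → ∃ δ₀ c₀` depending on `d`, `ℓ`, `α`
  and the window only — uniform in `k ≥ 1`, in the nested pair, in `x, x′`, `μ`, `f` and in `(a, m²)`; here `δ₀` may
  depend on `α` too (inherited from node 10, ultimately from (2.36) in `B4Green242Bridge`).

## HONEST SCOPE — what is NOT certified here

(i) Only `A = 0` (`D^η_{A,μ} = ∂^η_μ`, `U ≡ 1`, one component; «e sufficiently small» void).  (ii) Only NESTED BOXES: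
`Ω` AND `Ω₀` rectangular parallelepipeds with corners in the unit lattice (the print: `Ω ⊂ Ω₀` arbitrary unions of big
blocks, with the restriction `dist({x, x′}, Ω^c) ≥ R₀` unless `Ω` is a parallelepiped; nothing is said here about
non-box `Ω₀` or non-box `Ω`).  (iii) Only `0 ≤ α < 1` as printed («α < 1»; `α < 0` is not meant, see the dictionary of
`B4Thm19ZeroBoxHolder`); the core §4 allows `α ≤ 1` but the input row bound of node 10 is stated for `α < 1`.  (iv)
Distances are `ℓ^∞` fine-lattice distances over `n`, to `supp f` and to `Ω₀∖Ω`, as two-point minima for `{x, x′}` (see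
the DICTIONARY); the constants are existential (`δ₀ = min(δ₆, δ₇, δ₁₀)/2` of the three nodes' rates, `c₀ = c_H`).
(v) ROUTE: NOT the print's random-walk expansion (2.13)/(2.18) and its cancellation of interior-cube terms (p. 579) —
instead node 9's exact cutoff–commutator identity, fed by the clauses (1.10) and (1.9) at `A = 0` for boxes (nodes
6/7/10, themselves proved over (2.34)–(2.39)) on `Ω` and on `Ω₀`; the print's distance bookkeeping survives as
`key_dist`.  (vi) Together with `B4Delta112ZeroBox` this completes ALL THREE pointwise clauses (1.9)·(1.10)·(1.12) for
`δG_k(Ω, Ω₀, 0)` on nested boxes at `A = 0`; the `L²`-pairing sentence of Corollary 2.3 for `δG` is cell b04's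
`B4Cor23ZeroDelta` (carriers `B4Lower18.fineOpR`), not this file, and the typed leaf `B4.Ineq111_112` (an abstract
`EtaSetting`) is not instantiated here — whether anything of `DagBinding`/`DagDischarged` is bound to this file is the
carver's call.

**Value = kernel certificate (the Hölder clause of the `δG_k` sentence (1.11)–(1.12) of B4's Theorem at `A = 0` on
nested boxes, all scales, all `0 ≤ α < 1`, over the package's `A = 0` theorems), NOT summit progress**: the Yang–Mills /
`Summit.QuantumFields` statements are untouched; no Literature fact is minted — every hypothesis used is kernel-proved
in this package.
-/

namespace Literature.MathematicalPhysics.QuantumFieldTheory.Balaban1983to89.B4Delta112ZeroBoxHolder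

open Finset Matrix
open Literature.MathematicalPhysics.QuantumFieldTheory.Balaban1983to89.B4ContourShift (supNorm supNorm_nonneg
  abs_le_supNorm exists_supNorm_eq)
open Literature.MathematicalPhysics.QuantumFieldTheory.Balaban1983to89.B4TorusKernel (supNorm_neg
  sum_abs_le_mul_supNorm)
open Literature.MathematicalPhysics.QuantumFieldTheory.Balaban1983to89.B4Lower18 (supNorm_sub_le_one_of_mem_nbrs)
open Literature.MathematicalPhysics.QuantumFieldTheory.Balaban1983to89.B4TwoRegion120 (supNorm_sub_comm)
open Literature.MathematicalPhysics.QuantumFieldTheory.Balaban1983to89.B4Reflection242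
open Literature.MathematicalPhysics.QuantumFieldTheory.Balaban1983to89.B4BoxCov237
open Literature.MathematicalPhysics.QuantumFieldTheory.Balaban1983to89.B4Green242Bridge (boxNbrs boxBlk
  mem_boxNbrs_comm not_mem_boxNbrs_self mem_boxBlk_self)
open Literature.MathematicalPhysics.QuantumFieldTheory.Balaban1983to89.B4TwoBox120
open Literature.MathematicalPhysics.QuantumFieldTheory.Balaban1983to89.B4Thm110ZeroBox
open Literature.MathematicalPhysics.QuantumFieldTheory.Balaban1983to89.B4Thm110ZeroBoxDeriv
open Literature.MathematicalPhysics.QuantumFieldTheory.Balaban1983to89.B4Thm19ZeroBoxHolder (wsum2 wsum2_mono_rate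
  abs_sum_mul_le_of_wsum2 mulVec_dd thm19_zero_box_holder_roww thm19_zero_box_holder_roww_coeff)
open Literature.MathematicalPhysics.QuantumFieldTheory.Balaban1983to89.B4Delta112ZeroBox
open B4StripSumsHolder (one_le_supNorm)

noncomputable section

variable {d : ℕ}

/-! ## §1 The cutoff `χ` of node `B4Delta112ZeroBox` seen from two points: Lipschitz bounds at distance `|y′ − y|_∞`

(C1) of node 9 is the bond bound `n|χ(y) − χ(y′)| ≤ 8`; the Hölder quotient of a product needs the same at an arbitrary
pair of fine points, and the Lipschitz bound of the bond derivative `n∂_μχ` (from the second differences (C2′)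
`abs_fac_second_le`). -/

section ChiLip

/-- **GAP FORM OF THE FIRST DIFFERENCES**: `|φ(t + g) − φ(t)| ≤ 8g/n` on the fine interval (`t + g < m`, `n ≥ 1`).
[folklore] -/
theorem abs_fac_gap_le {n : ℕ} (hn : 1 ≤ n) (lo hi : Bool) {m : ℕ} (t g : ℕ) (h : t + g < m) :
    |fac n lo hi m (t + g) - fac n lo hi m t| ≤ 8 * (g : ℝ) / n := by
  induction g with
  | zero => simp
  | succ g ih =>
    have ih' := ih (by omega)
    have hn0 : (0 : ℝ) < n := by exact_mod_cast hn
    have hstep := abs_fac_succ_sub_le n lo hi (m := m) (t := t + g) (by omega)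
    rw [abs_mul, abs_of_pos hn0] at hstep
    have hstep' : |fac n lo hi m (t + g + 1) - fac n lo hi m (t + g)| ≤ 8 / n := by
      rw [le_div_iff₀ hn0, mul_comm]
      exact hstep
    rw [show t + (g + 1) = t + g + 1 by omega]
    calc |fac n lo hi m (t + g + 1) - fac n lo hi m t|
        = |(fac n lo hi m (t + g + 1) - fac n lo hi m (t + g)) + (fac n lo hi m (t + g) - fac n lo hi m t)| := by
          ring_nf
      _ ≤ |fac n lo hi m (t + g + 1) - fac n lo hi m (t + g)| + |fac n lo hi m (t + g) - fac n lo hi m t| :=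
          abs_add_le _ _
      _ ≤ 8 / n + 8 * (g : ℝ) / n := add_le_add hstep' ih'
      _ = 8 * ((g + 1 : ℕ) : ℝ) / n := by push_cast; ring

/-- **LIPSCHITZ BOUND OF THE ONE-DIMENSIONAL FACTOR**: `|φ(t′) − φ(t)| ≤ 8|t′ − t|/n` for `t, t′ < m`. [folklore] -/
theorem abs_fac_sub_le {n : ℕ} (hn : 1 ≤ n) (lo hi : Bool) {m t t' : ℕ} (ht : t < m) (ht' : t' < m) :
    |fac n lo hi m t' - fac n lo hi m t| ≤ 8 * |(t' : ℝ) - t| / n := by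
  rcases le_total t t' with h | h
  · obtain ⟨g, rfl⟩ := Nat.exists_eq_add_of_le h
    rw [show ((t + g : ℕ) : ℝ) - t = g by push_cast; ring, Nat.abs_cast]
    exact abs_fac_gap_le hn lo hi t g ht'
  · obtain ⟨g, rfl⟩ := Nat.exists_eq_add_of_le h
    rw [abs_sub_comm, show (t' : ℝ) - ((t' + g : ℕ) : ℝ) = -g by push_cast; ring, abs_neg, Nat.abs_cast]
    exact abs_fac_gap_le hn lo hi t' g ht

/-- the bond derivative of the one-dimensional factor: `n(φ(t+1) − φ(t))`. [folklore] -/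
def dfacB (n : ℕ) (lo hi : Bool) (m t : ℕ) : ℝ := (n : ℝ) * (fac n lo hi m (t + 1) - fac n lo hi m t)

/-- `|n(φ(t+1) − φ(t))| ≤ 8` (`t + 1 < m`). [folklore] -/
theorem abs_dfacB_le (n : ℕ) (lo hi : Bool) {m t : ℕ} (ht : t + 1 < m) : |dfacB n lo hi m t| ≤ 8 :=
  abs_fac_succ_sub_le n lo hi ht

/-- one step of the bond derivative: `|n(φ(t+2) − φ(t+1)) − n(φ(t+1) − φ(t))| ≤ 64/n` (`t + 2 < m`). [folklore] -/
theorem abs_dfacB_succ_sub_le {n : ℕ} (hn : 1 ≤ n) (lo hi : Bool) {m t : ℕ} (ht : t + 2 < m) :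
    |dfacB n lo hi m (t + 1) - dfacB n lo hi m t| ≤ 64 / n := by
  have h := abs_fac_second_le n lo hi ht
  have hn0 : (0 : ℝ) < n := by exact_mod_cast hn
  unfold dfacB
  rw [show t + 1 + 1 = t + 2 from rfl]
  have e : (n : ℝ) * (fac n lo hi m (t + 2) - fac n lo hi m (t + 1)) - (n : ℝ) * (fac n lo hi m (t + 1) - fac n lo hi m t)
      = -((n : ℝ) ^ 2 * (2 * fac n lo hi m (t + 1) - fac n lo hi m (t + 2) - fac n lo hi m t)) / n := by
    field_simp
    ring
  rw [e, abs_div, abs_neg, abs_of_pos hn0, div_le_div_iff_of_pos_right hn0]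
  exact h

/-- gap form: `|n∂φ(t + g) − n∂φ(t)| ≤ 64g/n` (`t + g + 1 < m`). [folklore] -/
theorem abs_dfacB_gap_le {n : ℕ} (hn : 1 ≤ n) (lo hi : Bool) {m : ℕ} (t g : ℕ) (h : t + g + 1 < m) :
    |dfacB n lo hi m (t + g) - dfacB n lo hi m t| ≤ 64 * (g : ℝ) / n := by
  induction g with
  | zero => simp
  | succ g ih =>
    have ih' := ih (by omega)
    have hstep := abs_dfacB_succ_sub_le hn lo hi (m := m) (t := t + g) (by omega)
    rw [show t + (g + 1) = t + g + 1 by omega]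
    calc |dfacB n lo hi m (t + g + 1) - dfacB n lo hi m t|
        = |(dfacB n lo hi m (t + g + 1) - dfacB n lo hi m (t + g)) + (dfacB n lo hi m (t + g) - dfacB n lo hi m t)| := by
          ring_nf
      _ ≤ |dfacB n lo hi m (t + g + 1) - dfacB n lo hi m (t + g)| + |dfacB n lo hi m (t + g) - dfacB n lo hi m t| :=
          abs_add_le _ _
      _ ≤ 64 / n + 64 * (g : ℝ) / n := add_le_add hstep ih'
      _ = 64 * ((g + 1 : ℕ) : ℝ) / n := by push_cast; ring

/-- **LIPSCHITZ BOUND OF THE BOND DERIVATIVE**: `|n∂φ(t′) − n∂φ(t)| ≤ 64|t′ − t|/n` (`t + 1, t′ + 1 < m`). [folklore] -/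
theorem abs_dfacB_sub_le {n : ℕ} (hn : 1 ≤ n) (lo hi : Bool) {m t t' : ℕ} (ht : t + 1 < m) (ht' : t' + 1 < m) :
    |dfacB n lo hi m t' - dfacB n lo hi m t| ≤ 64 * |(t' : ℝ) - t| / n := by
  rcases le_total t t' with h | h
  · obtain ⟨g, rfl⟩ := Nat.exists_eq_add_of_le h
    rw [show ((t + g : ℕ) : ℝ) - t = g by push_cast; ring, Nat.abs_cast]
    exact abs_dfacB_gap_le hn lo hi t g ht'
  · obtain ⟨g, rfl⟩ := Nat.exists_eq_add_of_le h
    rw [abs_sub_comm, show (t' : ℝ) - ((t' + g : ℕ) : ℝ) = -g by push_cast; ring, abs_neg, Nat.abs_cast]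
    exact abs_dfacB_gap_le hn lo hi t' g ht

/-- **PRODUCT TELESCOPING**: `|Π a_i − Π b_i| ≤ Σ |a_i − b_i|` for factors of modulus `≤ 1` (private: the generic
bound is landed in unrelated modules — e.g. `WalshDyadic.abs_prod_sub_prod_le`, `B5TorusPartition.abs_prod_sub_prod_le` —
whose import would take this leaf's dependencies outside the B4 lineage). [folklore] -/
private theorem abs_prod_sub_prod_le_sum_of_abs_le_one {ι : Type*} [DecidableEq ι] (S : Finset ι) (a b : ι → ℝ)
    (ha : ∀ i ∈ S, |a i| ≤ 1) (hb : ∀ i ∈ S, |b i| ≤ 1) :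
    |∏ i ∈ S, a i - ∏ i ∈ S, b i| ≤ ∑ i ∈ S, |a i - b i| := by
  induction S using Finset.induction_on with
  | empty => simp
  | @insert j S hj ih =>
    rw [Finset.prod_insert hj, Finset.prod_insert hj, Finset.sum_insert hj]
    have ha' : ∀ i ∈ S, |a i| ≤ 1 := fun i hi => ha i (Finset.mem_insert_of_mem hi)
    have hb' : ∀ i ∈ S, |b i| ≤ 1 := fun i hi => hb i (Finset.mem_insert_of_mem hi)
    have hPb : |∏ i ∈ S, b i| ≤ 1 := by
      rw [Finset.abs_prod]
      exact Finset.prod_le_one (fun i _ => abs_nonneg _) hb'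
    have e : a j * ∏ i ∈ S, a i - b j * ∏ i ∈ S, b i
        = a j * (∏ i ∈ S, a i - ∏ i ∈ S, b i) + (a j - b j) * ∏ i ∈ S, b i := by ring
    rw [e]
    calc |a j * (∏ i ∈ S, a i - ∏ i ∈ S, b i) + (a j - b j) * ∏ i ∈ S, b i|
        ≤ |a j| * |∏ i ∈ S, a i - ∏ i ∈ S, b i| + |a j - b j| * |∏ i ∈ S, b i| := by
          rw [← abs_mul, ← abs_mul]
          exact abs_add_le _ _
      _ ≤ 1 * (∑ i ∈ S, |a i - b i|) + |a j - b j| * 1 :=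
          add_le_add (mul_le_mul (ha j (Finset.mem_insert_self j S)) (ih ha' hb') (abs_nonneg _) zero_le_one)
            (mul_le_mul_of_nonneg_left hPb (abs_nonneg _))
      _ = |a j - b j| + ∑ i ∈ S, |a i - b i| := by ring

variable (M M0 : Fin (d + 1) → ℕ) (s : Fin (d + 1) → ℤ)

/-- the direction factor between two box points: `|φ_μ(y′_μ) − φ_μ(y_μ)| ≤ 8|y′_μ − y_μ|/n`. [folklore] -/
theorem abs_fdir_sub_le {n : ℕ} (hn : 1 ≤ n) {y y' : Fin (d + 1) → ℤ} (hy : y ∈ boxDom (fun i => n * M i))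
    (hy' : y' ∈ boxDom (fun i => n * M i)) (μ : Fin (d + 1)) :
    |fdir n M M0 s μ (y' μ) - fdir n M M0 s μ (y μ)| ≤ 8 * (((|y' μ - y μ| : ℤ) : ℝ)) / n := by
  obtain ⟨t, ht, htm⟩ := coord_eq_natCast hy μ
  obtain ⟨t', ht', htm'⟩ := coord_eq_natCast hy' μ
  rw [ht, ht', fdir_natCast, fdir_natCast]
  have h := abs_fac_sub_le hn (loF s μ) (hiF M M0 s μ) htm htm'
  exact_mod_cast h

/-- the `ℓ^∞` control of one coordinate difference, real form. [folklore] -/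
theorem abs_coord_sub_le_supNorm (y y' : Fin (d + 1) → ℤ) (μ : Fin (d + 1)) :
    (((|y' μ - y μ| : ℤ) : ℝ)) ≤ supNorm (y' - y) := by
  have h := abs_le_supNorm (y' - y) μ
  rwa [Pi.sub_apply] at h

/-- **LIPSCHITZ BOUND OF THE CUTOFF**: `|χ(y′) − χ(y)| ≤ 8(d+1)|y′ − y|_∞/n` for points of the inner fine box.
[folklore] -/
theorem abs_chi_sub_le {n : ℕ} (hn : 1 ≤ n) {y y' : Fin (d + 1) → ℤ} (hy : y ∈ boxDom (fun i => n * M i))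
    (hy' : y' ∈ boxDom (fun i => n * M i)) :
    |chi n M M0 s y' - chi n M M0 s y| ≤ 8 * ((d : ℝ) + 1) * supNorm (y' - y) / n := by
  unfold chi
  calc |∏ μ, fdir n M M0 s μ (y' μ) - ∏ μ, fdir n M M0 s μ (y μ)|
      ≤ ∑ μ, |fdir n M M0 s μ (y' μ) - fdir n M M0 s μ (y μ)| :=
        abs_prod_sub_prod_le_sum_of_abs_le_one _ _ _
          (fun μ _ => by rw [abs_of_nonneg (fdir_nonneg n M M0 s μ _)]; exact fdir_le_one n M M0 s μ _)
          (fun μ _ => by rw [abs_of_nonneg (fdir_nonneg n M M0 s μ _)]; exact fdir_le_one n M M0 s μ _)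
    _ ≤ ∑ _μ : Fin (d + 1), 8 * supNorm (y' - y) / n := by
        refine Finset.sum_le_sum fun μ _ => (abs_fdir_sub_le M M0 s hn hy hy' μ).trans ?_
        exact div_le_div_of_nonneg_right
          (mul_le_mul_of_nonneg_left (abs_coord_sub_le_supNorm y y' μ) (by norm_num)) (Nat.cast_nonneg n)
    _ = 8 * ((d : ℝ) + 1) * supNorm (y' - y) / n := by
        rw [Finset.sum_const, Finset.card_univ, Fintype.card_fin, nsmul_eq_mul]
        push_cast
        ring

/-- the same for the product of the other directions' factors. [folklore] -/
theorem abs_rest_sub_le {n : ℕ} (hn : 1 ≤ n) (μ : Fin (d + 1)) {y y' : Fin (d + 1) → ℤ}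
    (hy : y ∈ boxDom (fun i => n * M i)) (hy' : y' ∈ boxDom (fun i => n * M i)) :
    |rest n M M0 s μ y' - rest n M M0 s μ y| ≤ 8 * ((d : ℝ) + 1) * supNorm (y' - y) / n := by
  unfold rest
  have h8 : 0 ≤ 8 * supNorm (y' - y) / n := div_nonneg (mul_nonneg (by norm_num) (supNorm_nonneg _)) (Nat.cast_nonneg n)
  calc |∏ i ∈ Finset.univ.erase μ, fdir n M M0 s i (y' i) - ∏ i ∈ Finset.univ.erase μ, fdir n M M0 s i (y i)|
      ≤ ∑ i ∈ Finset.univ.erase μ, |fdir n M M0 s i (y' i) - fdir n M M0 s i (y i)| :=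
        abs_prod_sub_prod_le_sum_of_abs_le_one _ _ _
          (fun i _ => by rw [abs_of_nonneg (fdir_nonneg n M M0 s i _)]; exact fdir_le_one n M M0 s i _)
          (fun i _ => by rw [abs_of_nonneg (fdir_nonneg n M M0 s i _)]; exact fdir_le_one n M M0 s i _)
    _ ≤ ∑ _i ∈ Finset.univ.erase μ, 8 * supNorm (y' - y) / n := by
        refine Finset.sum_le_sum fun i _ => (abs_fdir_sub_le M M0 s hn hy hy' i).trans ?_
        exact div_le_div_of_nonneg_right
          (mul_le_mul_of_nonneg_left (abs_coord_sub_le_supNorm y y' i) (by norm_num)) (Nat.cast_nonneg n)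
    _ ≤ ∑ _i : Fin (d + 1), 8 * supNorm (y' - y) / n :=
        Finset.sum_le_sum_of_subset_of_nonneg (Finset.subset_univ _) fun _ _ _ => h8
    _ = 8 * ((d : ℝ) + 1) * supNorm (y' - y) / n := by
        rw [Finset.sum_const, Finset.card_univ, Fintype.card_fin, nsmul_eq_mul]
        push_cast
        ring

/-- the bond difference of `χ` in direction `μ` factorises: `n(χ(y + e_μ) − χ(y)) = n∂φ_μ(y_μ)·Π_{i≠μ}φ_i(y_i)`.
[folklore] -/
theorem chi_bond_eq (n : ℕ) (μ : Fin (d + 1)) {y ye : Fin (d + 1) → ℤ} (he : ye = y + Pi.single μ 1) {t : ℕ}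
    (ht : y μ = t) :
    (n : ℝ) * (chi n M M0 s ye - chi n M M0 s y) = dfacB n (loF s μ) (hiF M M0 s μ) (n * M μ) t * rest n M M0 s μ y := by
  have h1 : ye μ = ((t + 1 : ℕ) : ℤ) := by rw [he]; simp [ht]
  rw [chi_eq_mul_rest n M M0 s μ y, chi_eq_mul_rest n M M0 s μ ye, he, rest_add_single, ← he, ht, h1,
    fdir_natCast, fdir_natCast, dfacB]
  ring

/-- **LIPSCHITZ BOUND OF THE BOND DERIVATIVE OF THE CUTOFF**: for two bonds `⟨y, y + e_μ⟩`, `⟨y′, y′ + e_μ⟩` of the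
inner fine box, `|n(χ(y′+e_μ) − χ(y′)) − n(χ(y+e_μ) − χ(y))| ≤ 128(d+1)|y′ − y|_∞/n`. [folklore] -/
theorem abs_dchi_sub_le {n : ℕ} (hn : 1 ≤ n) (μ : Fin (d + 1)) {y ye y' ye' : Fin (d + 1) → ℤ}
    (hy : y ∈ boxDom (fun i => n * M i)) (hye : ye ∈ boxDom (fun i => n * M i))
    (hy' : y' ∈ boxDom (fun i => n * M i)) (hye' : ye' ∈ boxDom (fun i => n * M i))
    (he : ye = y + Pi.single μ 1) (he' : ye' = y' + Pi.single μ 1) :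
    |(n : ℝ) * (chi n M M0 s ye' - chi n M M0 s y') - (n : ℝ) * (chi n M M0 s ye - chi n M M0 s y)|
      ≤ 128 * ((d : ℝ) + 1) * supNorm (y' - y) / n := by
  obtain ⟨t, ht, htm⟩ := coord_eq_natCast hy μ
  obtain ⟨t', ht', htm'⟩ := coord_eq_natCast hy' μ
  have ht1 : t + 1 < n * M μ := by
    have := ((mem_boxDom.1 hye) μ).2
    rw [he, Pi.add_apply, Pi.single_eq_same, ht] at this
    exact_mod_cast this
  have ht1' : t' + 1 < n * M μ := by
    have := ((mem_boxDom.1 hye') μ).2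
    rw [he', Pi.add_apply, Pi.single_eq_same, ht'] at this
    exact_mod_cast this
  rw [chi_bond_eq M M0 s n μ he ht, chi_bond_eq M M0 s n μ he' ht']
  set A := dfacB n (loF s μ) (hiF M M0 s μ) (n * M μ) t
  set A' := dfacB n (loF s μ) (hiF M M0 s μ) (n * M μ) t'
  set R := rest n M M0 s μ y
  set R' := rest n M M0 s μ y'
  have hA : |A| ≤ 8 := abs_dfacB_le n _ _ ht1
  have hR' : |R'| ≤ 1 := abs_rest_le_one n M M0 s μ y'
  have hAA : |A' - A| ≤ 64 * supNorm (y' - y) / n := by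
    refine (abs_dfacB_sub_le hn _ _ ht1 ht1').trans ?_
    refine div_le_div_of_nonneg_right (mul_le_mul_of_nonneg_left ?_ (by norm_num)) (Nat.cast_nonneg n)
    have h := abs_coord_sub_le_supNorm y y' μ
    rw [ht, ht'] at h
    exact_mod_cast h
  have hRR : |R' - R| ≤ 8 * ((d : ℝ) + 1) * supNorm (y' - y) / n := abs_rest_sub_le M M0 s hn μ hy hy'
  have hS0 : 0 ≤ supNorm (y' - y) / n := div_nonneg (supNorm_nonneg _) (Nat.cast_nonneg n)
  have hd1 : (1 : ℝ) ≤ (d : ℝ) + 1 := by have := Nat.cast_nonneg (α := ℝ) d; linarith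
  have e : A' * R' - A * R = (A' - A) * R' + A * (R' - R) := by ring
  rw [e]
  calc |(A' - A) * R' + A * (R' - R)| ≤ |A' - A| * |R'| + |A| * |R' - R| := by
        rw [← abs_mul, ← abs_mul]; exact abs_add_le _ _
    _ ≤ 64 * supNorm (y' - y) / n * 1 + 8 * (8 * ((d : ℝ) + 1) * supNorm (y' - y) / n) :=
        add_le_add (mul_le_mul hAA hR' (abs_nonneg _)
            (div_nonneg (mul_nonneg (by norm_num) (supNorm_nonneg _)) (Nat.cast_nonneg n)))
          (mul_le_mul hA hRR (abs_nonneg _) (by norm_num))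
    _ = (64 + 64 * ((d : ℝ) + 1)) * (supNorm (y' - y) / n) := by ring
    _ ≤ (64 * ((d : ℝ) + 1) + 64 * ((d : ℝ) + 1)) * (supNorm (y' - y) / n) := by
        refine mul_le_mul_of_nonneg_right ?_ hS0
        linarith
    _ = 128 * ((d : ℝ) + 1) * supNorm (y' - y) / n := by ring

end ChiLip

/-! ## §2 Path telescoping of differenced kernel rows: `|u(x′) − u(x)|` at distance `|x′ − x|_∞ ≤ n`

For two fine points `y, y′` within `n` of a centre `x` (coordinatewise), the row difference `G(y′,·) − G(y,·)` is a
sum of `Σ_i|y′_i − y_i|` bond differences along a monotone lattice path (which stays in the box), each controlled by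
the weighted differenced-row bound of node 7 and re-centred at `x` at the cost `e^{δ}`. -/

section PathTel

variable {N : Fin (d + 1) → ℕ}

/-- re-centring a weighted `ℓ¹` functional from `z_b` to a point `x` with `|x − z_b|_∞ ≤ n` costs a factor `e^{δ}`.
[folklore] -/
theorem recentre_le {n : ℕ} (hn : 1 ≤ n) {δ : ℝ} (hδ : 0 ≤ δ) (x zb : ↥(boxDom N)) (hxz : supNorm (x.1 - zb.1) ≤ n)
    (g : ↥(boxDom N) → ℝ) :
    ∑ z, |g z| * Real.exp (δ * supNorm (x.1 - z.1) / n) ≤ Real.exp δ * wsum δ n zb g := by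
  unfold wsum
  rw [Finset.mul_sum]
  refine Finset.sum_le_sum fun z _ => ?_
  rw [mul_left_comm]
  refine mul_le_mul_of_nonneg_left ?_ (abs_nonneg _)
  rw [← Real.exp_add]
  refine Real.exp_le_exp.2 ?_
  have t := supNorm_sub_le_sub_add_sub x.1 zb.1 z.1
  have hn0 : (0 : ℝ) < n := by exact_mod_cast hn
  calc δ * supNorm (x.1 - z.1) / n ≤ δ * (n + supNorm (zb.1 - z.1)) / n :=
        div_le_div_of_nonneg_right (mul_le_mul_of_nonneg_left (by linarith) hδ) hn0.le
    _ = δ + δ * supNorm (zb.1 - z.1) / n := by field_simp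

/-- coordinatewise closeness gives `ℓ^∞` closeness. [folklore] -/
theorem supNorm_sub_le_of_coord {n : ℕ} {x y : Fin (d + 1) → ℤ} (h : ∀ i, |x i - y i| ≤ (n : ℤ)) :
    supNorm (x - y) ≤ n := by
  refine supNorm_le_of_forall fun i => ?_
  rw [Pi.sub_apply]
  exact_mod_cast h i

/-- **PATH TELESCOPING** (induction on the `ℓ¹` distance `m`): for `y, y′` coordinatewise within `n` of `x`,
`Σ_z |n(G(y′,z) − G(y,z))|e^{δ|x−z|_∞/n} ≤ m·e^{δ}·c`, `m = Σ_i|y′_i − y_i|`, from the weighted differenced-row bound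
`c` of every bond. [folklore] -/
theorem rowdiff_tel {n : ℕ} (hn : 1 ≤ n) {δ c : ℝ} (hδ : 0 ≤ δ) (G : Matrix ↥(boxDom N) ↥(boxDom N) ℝ)
    (hS1 : ∀ (μ : Fin (d + 1)) (z ze : ↥(boxDom N)), ze.1 = z.1 + Pi.single μ 1 →
      wsum δ n z (fun z' => (n : ℝ) * (G ze z' - G z z')) ≤ c)
    (x : ↥(boxDom N)) :
    ∀ (m : ℕ) (y y' : ↥(boxDom N)), (∀ i, |x.1 i - y.1 i| ≤ (n : ℤ)) → (∀ i, |x.1 i - y'.1 i| ≤ (n : ℤ)) →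
      (∑ i, |y'.1 i - y.1 i| : ℤ) = m →
      ∑ z, |(n : ℝ) * (G y' z - G y z)| * Real.exp (δ * supNorm (x.1 - z.1) / n) ≤ m * (Real.exp δ * c) := by
  intro m
  induction m with
  | zero =>
    intro y y' hy hy' hm
    have hyy : y' = y := by
      apply Subtype.ext
      funext i
      have h0 : ∀ j ∈ (Finset.univ : Finset (Fin (d + 1))), (0 : ℤ) ≤ |y'.1 j - y.1 j| := fun j _ => abs_nonneg _
      have h1 := (Finset.sum_eq_zero_iff_of_nonneg h0).1 (by exact_mod_cast hm) i (Finset.mem_univ i)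
      have h2 := abs_eq_zero.1 h1
      linarith
    subst hyy
    simp
  | succ m ih =>
    intro y y' hy hy' hm
    have hne : ∃ i, y'.1 i ≠ y.1 i := by
      by_contra h
      push Not at h
      have h0 : (∑ i, |y'.1 i - y.1 i| : ℤ) = 0 :=
        Finset.sum_eq_zero fun i _ => by rw [h i, sub_self, abs_zero]
      rw [h0] at hm
      exact absurd hm (by push_cast; omega)
    obtain ⟨i, hi⟩ := hne
    -- the combination step, for a middle point `y₁` with `|y′ − y₁|₁ = m` and a controlled bond `y ~ y₁`
    have comb : ∀ y₁ : ↥(boxDom N), (∀ j, |x.1 j - y₁.1 j| ≤ (n : ℤ)) → (∑ j, |y'.1 j - y₁.1 j| : ℤ) = m →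
        ∑ z, |(n : ℝ) * (G y₁ z - G y z)| * Real.exp (δ * supNorm (x.1 - z.1) / n) ≤ Real.exp δ * c →
        ∑ z, |(n : ℝ) * (G y' z - G y z)| * Real.exp (δ * supNorm (x.1 - z.1) / n)
          ≤ ((m + 1 : ℕ) : ℝ) * (Real.exp δ * c) := by
      intro y₁ hy₁ hm₁ hb
      have hIH := ih y₁ y' hy₁ hy' hm₁
      calc ∑ z, |(n : ℝ) * (G y' z - G y z)| * Real.exp (δ * supNorm (x.1 - z.1) / n)
          ≤ ∑ z, (|(n : ℝ) * (G y' z - G y₁ z)| + |(n : ℝ) * (G y₁ z - G y z)|)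
              * Real.exp (δ * supNorm (x.1 - z.1) / n) := by
            refine Finset.sum_le_sum fun z _ => mul_le_mul_of_nonneg_right ?_ (Real.exp_pos _).le
            rw [show (n : ℝ) * (G y' z - G y z) = (n : ℝ) * (G y' z - G y₁ z) + (n : ℝ) * (G y₁ z - G y z) by ring]
            exact abs_add_le _ _
        _ = ∑ z, |(n : ℝ) * (G y' z - G y₁ z)| * Real.exp (δ * supNorm (x.1 - z.1) / n)
            + ∑ z, |(n : ℝ) * (G y₁ z - G y z)| * Real.exp (δ * supNorm (x.1 - z.1) / n) := by
            rw [← Finset.sum_add_distrib]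
            exact Finset.sum_congr rfl fun z _ => by ring
        _ ≤ m * (Real.exp δ * c) + Real.exp δ * c := add_le_add hIH hb
        _ = ((m + 1 : ℕ) : ℝ) * (Real.exp δ * c) := by push_cast; ring
    rcases lt_or_gt_of_ne hi with hlt | hgt
    · -- `y′_i < y_i`: step down, `y₁ = y − e_i`, bond `⟨y₁, y⟩` with base `y₁`
      have hy0 : 0 ≤ y'.1 i := ((mem_boxDom.1 y'.2) i).1
      have hmem : y.1 - Pi.single i 1 ∈ boxDom N := (sub_single_mem_iff y.2 i).2 (by omega)
      set y₁ : ↥(boxDom N) := ⟨y.1 - Pi.single i 1, hmem⟩ with hy₁def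
      have hyv : y.1 = y₁.1 + Pi.single i 1 := by rw [hy₁def]; simp
      have hci : y₁.1 i = y.1 i - 1 := by simp only [hy₁def, Pi.sub_apply, Pi.single_eq_same]
      have hcoord : ∀ j, j ≠ i → y₁.1 j = y.1 j := fun j hj => by
        simp only [hy₁def, Pi.sub_apply, Pi.single_eq_of_ne hj, sub_zero]
      have hy₁ : ∀ j, |x.1 j - y₁.1 j| ≤ (n : ℤ) := by
        intro j
        by_cases hj : j = i
        · rw [hj, hci]
          have h1 := hy i
          have h2 := hy' i
          rw [abs_le] at h1 h2 ⊢
          constructor <;> omega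
        · rw [hcoord j hj]
          exact hy j
      have hm₁ : (∑ j, |y'.1 j - y₁.1 j| : ℤ) = m := by
        rw [← Finset.add_sum_erase Finset.univ (fun j => |y'.1 j - y.1 j|) (Finset.mem_univ i)] at hm
        rw [← Finset.add_sum_erase Finset.univ (fun j => |y'.1 j - y₁.1 j|) (Finset.mem_univ i)]
        have hrest : ∑ j ∈ Finset.univ.erase i, |y'.1 j - y₁.1 j| = ∑ j ∈ Finset.univ.erase i, |y'.1 j - y.1 j| :=
          Finset.sum_congr rfl fun j hj => by rw [hcoord j (Finset.ne_of_mem_erase hj)]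
        rw [hrest, hci]
        have e1 : |y'.1 i - (y.1 i - 1)| = |y'.1 i - y.1 i| - 1 := by
          rw [abs_of_nonpos (by omega : y'.1 i - (y.1 i - 1) ≤ 0), abs_of_nonpos (by omega : y'.1 i - y.1 i ≤ 0)]
          ring
        rw [e1]
        push_cast at hm ⊢
        omega
      refine comb y₁ hy₁ hm₁ ?_
      have hb := hS1 i y₁ y hyv
      have hrc := recentre_le hn hδ x y₁ (supNorm_sub_le_of_coord hy₁) (fun z' => (n : ℝ) * (G y z' - G y₁ z'))
      calc ∑ z, |(n : ℝ) * (G y₁ z - G y z)| * Real.exp (δ * supNorm (x.1 - z.1) / n)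
          = ∑ z, |(n : ℝ) * (G y z - G y₁ z)| * Real.exp (δ * supNorm (x.1 - z.1) / n) := by
            refine Finset.sum_congr rfl fun z _ => ?_
            rw [show (n : ℝ) * (G y₁ z - G y z) = -((n : ℝ) * (G y z - G y₁ z)) by ring, abs_neg]
        _ ≤ Real.exp δ * wsum δ n y₁ (fun z' => (n : ℝ) * (G y z' - G y₁ z')) := hrc
        _ ≤ Real.exp δ * c := mul_le_mul_of_nonneg_left hb (Real.exp_pos _).le
    · -- `y_i < y′_i`: step up, `y₁ = y + e_i`, bond `⟨y, y₁⟩` with base `y`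
      have hy0 : y'.1 i < N i := ((mem_boxDom.1 y'.2) i).2
      have hmem : y.1 + Pi.single i 1 ∈ boxDom N := (add_single_mem_iff y.2 i).2 (by omega)
      set y₁ : ↥(boxDom N) := ⟨y.1 + Pi.single i 1, hmem⟩ with hy₁def
      have hyv : y₁.1 = y.1 + Pi.single i 1 := by rw [hy₁def]
      have hci : y₁.1 i = y.1 i + 1 := by simp only [hy₁def, Pi.add_apply, Pi.single_eq_same]
      have hcoord : ∀ j, j ≠ i → y₁.1 j = y.1 j := fun j hj => by
        simp only [hy₁def, Pi.add_apply, Pi.single_eq_of_ne hj, add_zero]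
      have hy₁ : ∀ j, |x.1 j - y₁.1 j| ≤ (n : ℤ) := by
        intro j
        by_cases hj : j = i
        · rw [hj, hci]
          have h1 := hy i
          have h2 := hy' i
          rw [abs_le] at h1 h2 ⊢
          constructor <;> omega
        · rw [hcoord j hj]
          exact hy j
      have hm₁ : (∑ j, |y'.1 j - y₁.1 j| : ℤ) = m := by
        rw [← Finset.add_sum_erase Finset.univ (fun j => |y'.1 j - y.1 j|) (Finset.mem_univ i)] at hm
        rw [← Finset.add_sum_erase Finset.univ (fun j => |y'.1 j - y₁.1 j|) (Finset.mem_univ i)]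
        have hrest : ∑ j ∈ Finset.univ.erase i, |y'.1 j - y₁.1 j| = ∑ j ∈ Finset.univ.erase i, |y'.1 j - y.1 j| :=
          Finset.sum_congr rfl fun j hj => by rw [hcoord j (Finset.ne_of_mem_erase hj)]
        rw [hrest, hci]
        have e1 : |y'.1 i - (y.1 i + 1)| = |y'.1 i - y.1 i| - 1 := by
          rw [abs_of_nonneg (by omega : 0 ≤ y'.1 i - (y.1 i + 1)), abs_of_nonneg (by omega : 0 ≤ y'.1 i - y.1 i)]
          ring
        rw [e1]
        push_cast at hm ⊢
        omega
      refine comb y₁ hy₁ hm₁ ?_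
      have hb := hS1 i y y₁ hyv
      have hrc := recentre_le hn hδ x y (supNorm_sub_le_of_coord hy) (fun z' => (n : ℝ) * (G y₁ z' - G y z'))
      exact hrc.trans (mul_le_mul_of_nonneg_left hb (Real.exp_pos _).le)

/-- **THE ROW DIFFERENCE AT DISTANCE `|x′ − x|_∞ ≤ n`**, centred at `x`:
`Σ_z |n(G(x′,z) − G(x,z))|e^{δ|x−z|_∞/n} ≤ (d+1)|x′ − x|_∞·e^{δ}·c`. [folklore] -/
theorem rowdiff_le {n : ℕ} (hn : 1 ≤ n) {δ c : ℝ} (hδ : 0 ≤ δ) (hc : 0 ≤ c) (G : Matrix ↥(boxDom N) ↥(boxDom N) ℝ)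
    (hS1 : ∀ (μ : Fin (d + 1)) (z ze : ↥(boxDom N)), ze.1 = z.1 + Pi.single μ 1 →
      wsum δ n z (fun z' => (n : ℝ) * (G ze z' - G z z')) ≤ c)
    (x x' : ↥(boxDom N)) (hxx' : supNorm (x.1 - x'.1) ≤ n) :
    wsum δ n x (fun z => (n : ℝ) * (G x' z - G x z)) ≤ ((d : ℝ) + 1) * supNorm (x'.1 - x.1) * (Real.exp δ * c) := by
  have hx : ∀ i, |x.1 i - x.1 i| ≤ (n : ℤ) := fun i => by rw [sub_self, abs_zero]; exact_mod_cast Nat.zero_le n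
  have hx' : ∀ i, |x.1 i - x'.1 i| ≤ (n : ℤ) := by
    intro i
    have h := abs_le_supNorm (x.1 - x'.1) i
    rw [Pi.sub_apply] at h
    exact_mod_cast h.trans hxx'
  have hm0 : 0 ≤ (∑ i, |x'.1 i - x.1 i| : ℤ) := Finset.sum_nonneg fun i _ => abs_nonneg _
  have h := rowdiff_tel hn hδ G hS1 x (∑ i, |x'.1 i - x.1 i| : ℤ).toNat x x' hx hx'
    (Int.toNat_of_nonneg hm0).symm
  unfold wsum
  refine h.trans (mul_le_mul_of_nonneg_right ?_ (mul_nonneg (Real.exp_pos _).le hc))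
  have e : (((∑ i, |x'.1 i - x.1 i| : ℤ).toNat : ℕ) : ℝ) = (((∑ i, |x'.1 i - x.1 i| : ℤ)) : ℝ) := by
    exact_mod_cast Int.toNat_of_nonneg hm0
  rw [e, Int.cast_sum]
  have h2 := sum_abs_le_mul_supNorm (x'.1 - x.1)
  simp only [Pi.sub_apply] at h2
  exact_mod_cast h2

end PathTel

/-! ## §3 Two-centre pairing near the boundary

The two-centre weighted bound of node 10 (`wsum2`, weight `e^{δ·min(|x−z|,|x′−z|)/n}`) against a pointwise source
bound carrying the one-centre weight `e^{δ|x−z|/n}` (the cut source and the commutator source of node 9): for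
`|x − x′|_∞ ≤ n` the re-centring costs `e^{δ}`. -/

section Pair2

variable {N : Fin (d + 1) → ℕ}

/-- `|x − y|_∞ ≤ min(|x − y|_∞, |x′ − y|_∞) + n` when `|x − x′|_∞ ≤ n`. [folklore] -/
theorem supNorm_le_min_add {n : ℕ} (x x' y : Fin (d + 1) → ℤ) (hxx' : supNorm (x - x') ≤ n) :
    supNorm (x - y) ≤ min (supNorm (x - y)) (supNorm (x' - y)) + n := by
  rcases min_choice (supNorm (x - y)) (supNorm (x' - y)) with h | h
  · rw [h]
    linarith [(Nat.cast_nonneg n : (0 : ℝ) ≤ n)]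
  · rw [h]
    have t := supNorm_sub_le_sub_add_sub x x' y
    linarith

/-- **TWO-CENTRE WEIGHTED PAIRING**: a two-centre weighted `ℓ¹` bound `c` of `g` about `x, x′` (`|x − x′|_∞ ≤ n`)
against `|h(y)| ≤ e^{δ|x−y|_∞/n}Φ` gives `|Σ g h| ≤ c·e^{δ}·Φ`. [folklore] -/
theorem abs_sum_mul_le_of_weight2 {n : ℕ} {δ c Φ : ℝ} (hδ : 0 ≤ δ) (x x' : ↥(boxDom N))
    (hxx' : supNorm (x.1 - x'.1) ≤ n) (g h : ↥(boxDom N) → ℝ) (hg : wsum2 δ n x x' g ≤ c) (hΦ : 0 ≤ Φ)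
    (hh : ∀ y, |h y| ≤ Real.exp (δ * supNorm (x.1 - y.1) / n) * Φ) :
    |∑ y, g y * h y| ≤ c * (Real.exp δ * Φ) := by
  unfold wsum2 at hg
  have key : ∀ y : ↥(boxDom N), Real.exp (δ * supNorm (x.1 - y.1) / n) * Φ
      ≤ Real.exp (δ * min (supNorm (x.1 - y.1)) (supNorm (x'.1 - y.1)) / n) * (Real.exp δ * Φ) := by
    intro y
    rw [← mul_assoc, ← Real.exp_add]
    refine mul_le_mul_of_nonneg_right (Real.exp_le_exp.2 ?_) hΦ
    have h1 := supNorm_le_min_add (n := n) x.1 x'.1 y.1 hxx'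
    rcases Nat.eq_zero_or_pos n with h0 | hpos
    · subst h0
      simpa using hδ
    · have hn0 : (0 : ℝ) < n := by exact_mod_cast hpos
      calc δ * supNorm (x.1 - y.1) / n
          ≤ δ * (min (supNorm (x.1 - y.1)) (supNorm (x'.1 - y.1)) + n) / n :=
            div_le_div_of_nonneg_right (mul_le_mul_of_nonneg_left h1 hδ) hn0.le
        _ = δ * min (supNorm (x.1 - y.1)) (supNorm (x'.1 - y.1)) / n + δ := by field_simp
  calc |∑ y, g y * h y| ≤ ∑ y, |g y| * |h y| :=
        (Finset.abs_sum_le_sum_abs _ _).trans (le_of_eq (Finset.sum_congr rfl fun y _ => abs_mul _ _))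
    _ ≤ ∑ y, |g y| * (Real.exp (δ * min (supNorm (x.1 - y.1)) (supNorm (x'.1 - y.1)) / n) * (Real.exp δ * Φ)) :=
        Finset.sum_le_sum fun y _ => mul_le_mul_of_nonneg_left ((hh y).trans (key y)) (abs_nonneg _)
    _ = (∑ y, |g y| * Real.exp (δ * min (supNorm (x.1 - y.1)) (supNorm (x'.1 - y.1)) / n)) * (Real.exp δ * Φ) := by
        rw [Finset.sum_mul]
        exact Finset.sum_congr rfl fun y _ => by ring
    _ ≤ c * (Real.exp δ * Φ) := mul_le_mul_of_nonneg_right hg (by positivity)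

/-- the Hölder weight against a Lipschitz gain: `(n/s)^α·(s/n) ≤ 1` for `1 ≤ s ≤ n`, `0 ≤ α ≤ 1`. [folklore] -/
theorem holderWeight_mul_le_one {n : ℕ} {sN α : ℝ} (hs1 : 1 ≤ sN) (hsn : sN ≤ n) (hα1 : α ≤ 1) :
    ((n : ℝ) / sN) ^ α * (sN / n) ≤ 1 := by
  have hs0 : 0 < sN := lt_of_lt_of_le one_pos hs1
  have hn0 : (0 : ℝ) < n := lt_of_lt_of_le hs0 hsn
  have hb : 1 ≤ (n : ℝ) / sN := (one_le_div hs0).2 hsn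
  calc ((n : ℝ) / sN) ^ α * (sN / n) ≤ ((n : ℝ) / sN) ^ (1 : ℝ) * (sN / n) :=
        mul_le_mul_of_nonneg_right (Real.rpow_le_rpow_of_exponent_le hb hα1) (div_nonneg hs0.le hn0.le)
    _ = 1 := by rw [Real.rpow_one]; field_simp

/-- … and `(n/s)^α ≤ 1` for `n ≤ s` (far pairs). [folklore] -/
theorem holderWeight_le_one {n : ℕ} {sN α : ℝ} (hs0 : 0 < sN) (hsn : (n : ℝ) ≤ sN) (hα0 : 0 ≤ α) :
    ((n : ℝ) / sN) ^ α ≤ 1 :=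
  Real.rpow_le_one (div_nonneg (Nat.cast_nonneg n) hs0.le) ((div_le_one hs0).2 hsn) hα0

end Pair2

/-! ## §4 The core estimate: the Hölder clause of (1.9) for `δG` with the factor (1.12), from five row bounds

Inner fine box `X = Π[0,nM)`, outer `X₀ = Π[0,nM₀)` (`B4TwoBox120.Fits M M₀ s`, translation by `ns`), `2 ≤ n`,
`G = H(□)⁻¹`, `G₀ = H(□₀)⁻¹` (`H = boxOpR n A m²`, `A > 0` the coefficient of `P_k`).  Used: the weighted row bound
of `G` (node 6), the weighted differenced-row bounds of `G` and `G₀` (node 7), the two-centre weighted Hölder-row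
bounds of `G` and `G₀` (node 10), all at one rate `δ` and height `c`; and node 9's decomposition
`δG f = (1−χ)u − G₀E((1−χ)f) + G₀E([H,χ]u)` with its source bounds `value_pt`, `deriv_pt`, `cutf_pt`, `comm_pt` and the
distance bookkeeping `key_dist`. -/

section Core

variable {n : ℕ} {M M0 : Fin (d + 1) → ℕ} {s : Fin (d + 1) → ℤ}

/-- the constant of the Hölder core estimate: `c·e^{4δ}·(150(d+1) + (160(d+1) + 2A₊)c)`. [folklore] -/
def cH (d : ℕ) (Ab δ c : ℝ) : ℝ :=
  c * Real.exp (4 * δ) * (150 * ((d : ℝ) + 1) + (160 * ((d : ℝ) + 1) + 2 * Ab) * c)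

/-- `0 ≤ c_H`. [folklore] -/
theorem cH_nonneg (d : ℕ) {Ab δ c : ℝ} (hAb : 0 ≤ Ab) (hc : 0 ≤ c) : 0 ≤ cH d Ab δ c := by
  unfold cH
  have : 0 ≤ (160 * ((d : ℝ) + 1) + 2 * Ab) * c := mul_nonneg (by positivity) hc
  exact mul_nonneg (mul_nonneg hc (Real.exp_pos _).le) (by positivity)

/-- `0 < c_H` for `c > 0`. [folklore] -/
theorem cH_pos (d : ℕ) {Ab δ c : ℝ} (hAb : 0 ≤ Ab) (hc : 0 < c) : 0 < cH d Ab δ c := by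
  unfold cH
  have : 0 ≤ (160 * ((d : ℝ) + 1) + 2 * Ab) * c := mul_nonneg (by positivity) hc.le
  exact mul_pos (mul_pos hc (Real.exp_pos _)) (by positivity)

/-- two copies of node 9's constant fit under `c_H`: `2c_core ≤ c_H`. [folklore] -/
theorem two_cCore_le_cH (d : ℕ) {Ab δ c : ℝ} (hc : 0 ≤ c) : 2 * cCore d Ab δ c ≤ cH d Ab δ c := by
  unfold cCore cH
  have hd : (0 : ℝ) ≤ d := Nat.cast_nonneg d
  have h1 : 0 ≤ c * Real.exp (4 * δ) := mul_nonneg hc (Real.exp_pos _).le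
  have h2 : 2 * (10 + (80 * ((d : ℝ) + 1) + Ab) * c) ≤ 150 * ((d : ℝ) + 1) + (160 * ((d : ℝ) + 1) + 2 * Ab) * c := by
    nlinarith
  calc 2 * (c * Real.exp (4 * δ) * (10 + (80 * ((d : ℝ) + 1) + Ab) * c))
      = c * Real.exp (4 * δ) * (2 * (10 + (80 * ((d : ℝ) + 1) + Ab) * c)) := by ring
    _ ≤ _ := mul_le_mul_of_nonneg_left h2 h1

/-- the near-pair budget fits under `c_H`: `c·e^{4δ}·(145(d+1) + 1 + (80(d+1) + A₊)c) ≤ c_H`. [folklore] -/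
theorem near_le_cH (d : ℕ) {Ab δ c : ℝ} (hAb : 0 ≤ Ab) (hc : 0 ≤ c) :
    c * Real.exp (4 * δ) * (145 * ((d : ℝ) + 1) + 1 + (80 * ((d : ℝ) + 1) + Ab) * c) ≤ cH d Ab δ c := by
  unfold cH
  have hd : (0 : ℝ) ≤ d := Nat.cast_nonneg d
  have h1 : 0 ≤ c * Real.exp (4 * δ) := mul_nonneg hc (Real.exp_pos _).le
  refine mul_le_mul_of_nonneg_left ?_ h1
  nlinarith

/-- `emb` is injective on values. [folklore] -/
theorem emb_ne (hs : Fits M M0 s) {x x' : ↥(boxDom (fun i => n * M i))} (h : x'.1 ≠ x.1) :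
    (emb (hs.scale n) x').1 ≠ (emb (hs.scale n) x).1 := by
  intro he
  apply h
  have := emb_sub_emb hs x' x
  rw [he, sub_self] at this
  exact (sub_eq_zero.1 this.symm)

/-- a translated bond is a bond. [folklore] -/
theorem emb_bond (hs : Fits M M0 s) {μ : Fin (d + 1)} {x xe : ↥(boxDom (fun i => n * M i))}
    (hxe : xe.1 = x.1 + Pi.single μ 1) : (emb (hs.scale n) xe).1 = (emb (hs.scale n) x).1 + Pi.single μ 1 := by
  rw [emb_val, emb_val, hxe]
  abel

/-- **CORE, HÖLDER CLAUSE.**  For the nested pair and the five row bounds at rate `δ`, height `c`: for every axis `μ`,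
all `x ≠ x′` in `X` with `x + e_μ, x′ + e_μ ∈ X`, every `f` with `|f| ≤ F` and all `D, D_b, D_f` with
`D ≤ min(|x − z|, |x′ − z|)` on `supp f`, `D_b ≤ min(|x + ns − y|, |x′ + ns − y|)` on `X₀∖(X + ns)`, `D_f ≤ |supp f + ns − y|`
there: `(n/|x′−x|_∞)^α·|n((δGf(x′+e_μ) − δGf(x′)) − (δGf(x+e_μ) − δGf(x)))| ≤ c_H·e^{−(δ/2)D/n}e^{−((δ/2)D_b + (δ/2)D_f)/n}·F`
(`0 ≤ α ≤ 1`; the printed statement it serves is B4 (1.9)·(1.12) at `A = 0` for boxes, `delta112_zero_box_holder`).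
Far pairs (`|x′ − x|_∞ ≥ n`, weight `≤ 1`): node 9's `core_deriv` at `x` and at `x′`.  Near pairs: the decomposition
`deltaG_decomp` at the four points; the term `(1−χ)u` by the discrete product rule (two-centre bound of `u`, Lipschitz
bounds of `χ` and `n∂_μχ`, path telescoping for `u(x′) − u(x)`), the two `G₀` terms by the two-centre bound on `X₀`
paired with `cutf_pt` / `comm_pt`. [folklore] -/
theorem core_holder (hn : 2 ≤ n) (hs : Fits M M0 s) (hM : ∀ i, 1 ≤ M i) {A Ab m2 δ c α : ℝ} (hA : 0 < A)
    (hAb : A ≤ Ab) (hm : 0 ≤ m2) (hδ : 0 ≤ δ) (hc : 0 ≤ c) (hα0 : 0 ≤ α) (hα1 : α ≤ 1)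
    (hS0 : ∀ z, roww δ n (boxOpR n A m2 M)⁻¹ z ≤ c)
    (hS1 : ∀ (μ : Fin (d + 1)) (z ze : ↥(boxDom (fun i => n * M i))), ze.1 = z.1 + Pi.single μ 1 →
      wsum δ n z (fun z' => (n : ℝ) * ((boxOpR n A m2 M)⁻¹ ze z' - (boxOpR n A m2 M)⁻¹ z z')) ≤ c)
    (hS2 : ∀ (μ : Fin (d + 1)) (z ze z' ze' : ↥(boxDom (fun i => n * M i))), ze.1 = z.1 + Pi.single μ 1 →
      ze'.1 = z'.1 + Pi.single μ 1 → z'.1 ≠ z.1 →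
      wsum2 δ n z z' (fun w => ((n : ℝ) / supNorm (z'.1 - z.1)) ^ α * ((n : ℝ) *
        (((boxOpR n A m2 M)⁻¹ ze' w - (boxOpR n A m2 M)⁻¹ z' w) - ((boxOpR n A m2 M)⁻¹ ze w - (boxOpR n A m2 M)⁻¹ z w))))
        ≤ c)
    (hR1 : ∀ (μ : Fin (d + 1)) (y ye : ↥(boxDom (fun i => n * M0 i))), ye.1 = y.1 + Pi.single μ 1 →
      wsum δ n y (fun y' => (n : ℝ) * ((boxOpR n A m2 M0)⁻¹ ye y' - (boxOpR n A m2 M0)⁻¹ y y')) ≤ c)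
    (hR2 : ∀ (μ : Fin (d + 1)) (y ye y' ye' : ↥(boxDom (fun i => n * M0 i))), ye.1 = y.1 + Pi.single μ 1 →
      ye'.1 = y'.1 + Pi.single μ 1 → y'.1 ≠ y.1 →
      wsum2 δ n y y' (fun w => ((n : ℝ) / supNorm (y'.1 - y.1)) ^ α * ((n : ℝ) *
        (((boxOpR n A m2 M0)⁻¹ ye' w - (boxOpR n A m2 M0)⁻¹ y' w)
          - ((boxOpR n A m2 M0)⁻¹ ye w - (boxOpR n A m2 M0)⁻¹ y w)))) ≤ c)
    (f : ↥(boxDom (fun i => n * M i)) → ℝ) {F D Db Df : ℝ} (hF : ∀ z, |f z| ≤ F)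
    (μ : Fin (d + 1)) (x xe x' xe' : ↥(boxDom (fun i => n * M i))) (hxe : xe.1 = x.1 + Pi.single μ 1)
    (hxe' : xe'.1 = x'.1 + Pi.single μ 1) (hne : x'.1 ≠ x.1)
    (hD : ∀ z, f z ≠ 0 → D ≤ min (supNorm (x.1 - z.1)) (supNorm (x'.1 - z.1)))
    (hDb : ∀ y : ↥(boxDom (fun i => n * M0 i)), (y.1 - fun i => (n : ℤ) * s i) ∉ boxDom (fun i => n * M i) →
      Db ≤ min (supNorm ((emb (hs.scale n) x).1 - y.1)) (supNorm ((emb (hs.scale n) x').1 - y.1)))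
    (hDf : ∀ z, f z ≠ 0 → ∀ y : ↥(boxDom (fun i => n * M0 i)),
      (y.1 - fun i => (n : ℤ) * s i) ∉ boxDom (fun i => n * M i) → Df ≤ supNorm ((emb (hs.scale n) z).1 - y.1)) :
    ((n : ℝ) / supNorm (x'.1 - x.1)) ^ α *
        |(n : ℝ) * ((dG n A m2 hs f xe' - dG n A m2 hs f x') - (dG n A m2 hs f xe - dG n A m2 hs f x))|
      ≤ cH d Ab δ c * dfac (δ / 2) n D Db Df * F := by
  have hn1 : 1 ≤ n := by omega
  have hn0 : (0 : ℝ) < n := by exact_mod_cast (show 0 < n by omega)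
  have hF0 : 0 ≤ F := (abs_nonneg _).trans (hF x)
  have hAb0 : 0 ≤ Ab := hA.le.trans hAb
  have hd1 : (1 : ℝ) ≤ (d : ℝ) + 1 := by have := Nat.cast_nonneg (α := ℝ) d; linarith
  set P := dfac (δ / 2) n D Db Df * F with hP
  have hP0 : 0 ≤ P := mul_nonneg (dfac_pos _ _ _ _ _).le hF0
  set sN := supNorm (x'.1 - x.1) with hsN
  have hs1 : 1 ≤ sN := one_le_supNorm (sub_ne_zero.2 hne)
  have hs0 : 0 < sN := lt_of_lt_of_le one_pos hs1
  set W := ((n : ℝ) / sN) ^ α with hW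
  have hW0 : 0 ≤ W := Real.rpow_nonneg (div_nonneg hn0.le hs0.le) α
  clear_value P sN W
  have hn0' : (n : ℝ) ≠ 0 := ne_of_gt hn0
  -- single-point distance hypotheses
  have hDx : ∀ z, f z ≠ 0 → D ≤ supNorm (x.1 - z.1) := fun z hz => (hD z hz).trans (min_le_left _ _)
  have hDx' : ∀ z, f z ≠ 0 → D ≤ supNorm (x'.1 - z.1) := fun z hz => (hD z hz).trans (min_le_right _ _)
  have hDbx : ∀ y : ↥(boxDom (fun i => n * M0 i)), (y.1 - fun i => (n : ℤ) * s i) ∉ boxDom (fun i => n * M i) →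
      Db ≤ supNorm ((emb (hs.scale n) x).1 - y.1) := fun y hy => (hDb y hy).trans (min_le_left _ _)
  have hDbx' : ∀ y : ↥(boxDom (fun i => n * M0 i)), (y.1 - fun i => (n : ℤ) * s i) ∉ boxDom (fun i => n * M i) →
      Db ≤ supNorm ((emb (hs.scale n) x').1 - y.1) := fun y hy => (hDb y hy).trans (min_le_right _ _)
  have hcc : cCore d Ab δ c * dfac (δ / 2) n D Db Df * F = cCore d Ab δ c * P := by rw [hP]; ring
  by_cases hfar : (n : ℝ) ≤ sN
  · -- FAR PAIRS: weight ≤ 1, two derivative clauses of node 9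
    have hW1 : W ≤ 1 := by rw [hW]; exact holderWeight_le_one hs0 hfar hα0
    have h1 := core_deriv hn hs hM hA hAb hm hδ hc hS0 hS1 hR1 f hF μ x xe hxe hDx hDbx hDf
    have h2 := core_deriv hn hs hM hA hAb hm hδ hc hS0 hS1 hR1 f hF μ x' xe' hxe' hDx' hDbx' hDf
    rw [hcc] at h1 h2
    calc W * |(n : ℝ) * ((dG n A m2 hs f xe' - dG n A m2 hs f x') - (dG n A m2 hs f xe - dG n A m2 hs f x))|
        ≤ 1 * (|(n : ℝ) * (dG n A m2 hs f xe' - dG n A m2 hs f x')|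
            + |(n : ℝ) * (dG n A m2 hs f xe - dG n A m2 hs f x)|) := by
          refine mul_le_mul hW1 ?_ (abs_nonneg _) zero_le_one
          rw [mul_sub]
          exact abs_sub _ _
      _ ≤ cCore d Ab δ c * P + cCore d Ab δ c * P := by rw [one_mul]; exact add_le_add h2 h1
      _ = 2 * cCore d Ab δ c * P := by ring
      _ ≤ cH d Ab δ c * P := mul_le_mul_of_nonneg_right (two_cCore_le_cH d hc) hP0
      _ = cH d Ab δ c * dfac (δ / 2) n D Db Df * F := by rw [hP]; ring
  · -- NEAR PAIRS: `|x′ − x|_∞ + 1 ≤ n`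
    push Not at hfar
    set G := (boxOpR n A m2 M)⁻¹ with hG
    set G0 := (boxOpR n A m2 M0)⁻¹ with hG0
    set u := G *ᵥ f with hu
    clear_value G G0 u
    have hnear : sN + 1 ≤ n := by
      obtain ⟨i, hi⟩ := exists_supNorm_eq (x'.1 - x.1)
      have hlt : (((|(x'.1 - x.1) i| : ℤ)) : ℝ) < n := by rw [← hi, ← hsN]; exact hfar
      have hlt' : |(x'.1 - x.1) i| < (n : ℤ) := by exact_mod_cast hlt
      have hle : |(x'.1 - x.1) i| + 1 ≤ (n : ℤ) := Int.add_one_le_iff.mpr hlt'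
      have : (((|(x'.1 - x.1) i| : ℤ)) : ℝ) + 1 ≤ n := by exact_mod_cast hle
      rw [← hi, ← hsN] at this
      exact this
    have hsn : sN ≤ n := by linarith
    have hcomm : supNorm (x.1 - x'.1) = sN := by rw [hsN, supNorm_sub_comm]
    have hxx' : supNorm (x.1 - x'.1) ≤ n := by rw [hcomm]; exact hsn
    have hx0 : supNorm (x.1 - x.1) ≤ n := by rw [sub_self, supNorm_zero']; exact Nat.cast_nonneg n
    have hxxe : supNorm (x.1 - xe.1) ≤ n := by
      rw [hxe, show x.1 - (x.1 + Pi.single μ 1) = -(Pi.single μ (1 : ℤ) : Fin (d + 1) → ℤ) by abel, supNorm_neg]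
      exact (supNorm_single_le μ).trans (by exact_mod_cast hn1)
    have hxxe' : supNorm (x.1 - xe'.1) ≤ n := by
      have h1 := supNorm_sub_le_sub_add_sub x.1 x'.1 xe'.1
      have h2 : supNorm (x'.1 - xe'.1) ≤ 1 := by
        rw [hxe', show x'.1 - (x'.1 + Pi.single μ 1) = -(Pi.single μ (1 : ℤ) : Fin (d + 1) → ℤ) by abel,
          supNorm_neg]
        exact supNorm_single_le μ
      rw [hcomm] at h1
      linarith
    have hWs : W * (sN / n) ≤ 1 := by rw [hW]; exact holderWeight_mul_le_one hs1 hsn hα1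
    have hxen : xe ∈ boxNbrs (fun i => n * M i) x := by
      unfold boxNbrs
      rw [Finset.mem_filter]
      exact ⟨Finset.mem_univ _, mem_nbrs.2 ⟨μ, Or.inl hxe⟩⟩
    -- the decomposition at the four points
    have hχ : ∀ z, (extNbrs n hs z).Nonempty → (fun z' => chi n M M0 s z'.1) z = 0 :=
      fun z hz => chi_eq_zero_of_extNbrs hn1 hs z hz
    have hdx := deltaG_decomp hn1 hA hm hs hM (fun z' => chi n M M0 s z'.1) hχ f x
    have hdxe := deltaG_decomp hn1 hA hm hs hM (fun z' => chi n M M0 s z'.1) hχ f xe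
    have hdx' := deltaG_decomp hn1 hA hm hs hM (fun z' => chi n M M0 s z'.1) hχ f x'
    have hdxe' := deltaG_decomp hn1 hA hm hs hM (fun z' => chi n M M0 s z'.1) hχ f xe'
    unfold dG
    rw [← hG, ← hG0] at hdx hdxe hdx' hdxe' ⊢
    rw [hdx, hdxe, hdx', hdxe', ← hu]
    -- the key distance (z = x; z′ = x and z′ = x′)
    have hbdK : Bd n hs x → ∀ z'', f z'' ≠ 0 →
        (D + Db + Df) / 2 - 3 * n - supNorm (x.1 - x.1) ≤ min (supNorm (x.1 - z''.1)) (supNorm (x'.1 - z''.1)) := by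
      intro hbd z'' hf
      exact le_min (key_dist hs hDx hDbx hDf hbd hx0 z'' hf) (key_dist hs hDx hDbx hDf hbd hxx' z'' hf)
    -- the common size `B = c·e^{3δ}·P` of the one-point bounds at `x`
    set B := c * Real.exp (3 * δ) * P with hB
    have hB0 : 0 ≤ B := mul_nonneg (mul_nonneg hc (Real.exp_pos _).le) hP0
    clear_value B
    have hBform : c * (Real.exp (3 * δ) * Real.exp (δ * supNorm (x.1 - x.1) / n) * dfac (δ / 2) n D Db Df) * F = B := by
      rw [sub_self, supNorm_zero', mul_zero, zero_div, Real.exp_zero, mul_one, hB, hP]; ring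
    have hDform : c * Real.exp (-(δ * ((D + Db + Df) / 2 - 3 * n - supNorm (x.1 - x.1)) / n)) * F = B := by
      rw [exp_Dprime hn1]; exact hBform
    ------------------------------------------------------------------
    -- T1: the cut term `(1 − χ)u`
    ------------------------------------------------------------------
    have hT1 : W * |(n : ℝ) * (((1 - chi n M M0 s xe'.1) * u xe' - (1 - chi n M M0 s x'.1) * u x')
          - ((1 - chi n M M0 s xe.1) * u xe - (1 - chi n M M0 s x.1) * u x))|
        ≤ 145 * (((d : ℝ) + 1) * Real.exp δ * B) := by
      by_cases hbd : Bd n hs x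
      · -- (i) the two-centre Hölder bound of `u`
        have hI : W * |(n : ℝ) * ((u xe' - u x') - (u xe - u x))| ≤ B := by
          rw [← abs_of_nonneg hW0, ← abs_mul, hu, mulVec_dd]
          have hg := hS2 μ x xe x' xe' hxe hxe' hne
          rw [← hsN, ← hW] at hg
          have h := abs_sum_mul_le_of_wsum2 hδ n x x' _ hg f hF (hbdK hbd)
          rw [hDform] at h
          exact h
        -- (ii) Lipschitz of `χ` at distance `sN` times the bond difference of `u` at `x`
        have hII : W * (|chi n M M0 s xe.1 - chi n M M0 s xe'.1| * |(n : ℝ) * (u xe - u x)|)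
            ≤ 8 * (((d : ℝ) + 1) * B) := by
          have hd := deriv_pt hn1 hs hδ G hS1 f hF x hDx hDbx hDf hbd hxen
          rw [← hu, hBform] at hd
          have hχL : |chi n M M0 s xe.1 - chi n M M0 s xe'.1| ≤ 8 * ((d : ℝ) + 1) * sN / n := by
            have h := abs_chi_sub_le M M0 s hn1 xe'.2 xe.2
            have e : supNorm (xe.1 - xe'.1) = sN := by
              rw [hsN, ← supNorm_neg (xe.1 - xe'.1), hxe, hxe']
              congr 1
              abel
            rw [e] at h
            exact h
          calc W * (|chi n M M0 s xe.1 - chi n M M0 s xe'.1| * |(n : ℝ) * (u xe - u x)|)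
              ≤ W * (8 * ((d : ℝ) + 1) * sN / n * B) :=
                mul_le_mul_of_nonneg_left (mul_le_mul hχL hd (abs_nonneg _)
                  (div_nonneg (mul_nonneg (by positivity) hs0.le) hn0.le)) hW0
            _ = 8 * (((d : ℝ) + 1) * B) * (W * (sN / n)) := by ring
            _ ≤ 8 * (((d : ℝ) + 1) * B) * 1 := mul_le_mul_of_nonneg_left hWs (by positivity)
            _ = 8 * (((d : ℝ) + 1) * B) := mul_one _
        -- (iii) the bond difference of `χ` at `x′` times `u(x′) − u(x)` (path telescoping)
        have hIII : W * (|(n : ℝ) * (chi n M M0 s x'.1 - chi n M M0 s xe'.1)| * |u x' - u x|)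
            ≤ 8 * (((d : ℝ) + 1) * Real.exp δ * B) := by
          have hχb : |(n : ℝ) * (chi n M M0 s x'.1 - chi n M M0 s xe'.1)| ≤ 8 :=
            abs_chi_sub_nbr_le n M M0 s x'.2 xe'.2 (mem_nbrs.2 ⟨μ, Or.inl hxe'⟩)
          have hrow := rowdiff_le hn1 hδ hc G hS1 x x' hxx'
          rw [← hsN] at hrow
          have hKx : ∀ z'', f z'' ≠ 0 → (D + Db + Df) / 2 - 3 * n - supNorm (x.1 - x.1) ≤ supNorm (x.1 - z''.1) :=
            key_dist hs hDx hDbx hDf hbd hx0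
          have hdu : |(n : ℝ) * (u x' - u x)| ≤ ((d : ℝ) + 1) * sN * (Real.exp δ * c)
              * Real.exp (-(δ * ((D + Db + Df) / 2 - 3 * n - supNorm (x.1 - x.1)) / n)) * F := by
            rw [hu, mulVec_sub_mulVec]
            exact abs_sum_mul_le_of_wsum hδ n x _ hrow f hF hKx
          have hdu' : |u x' - u x| ≤ ((d : ℝ) + 1) * (sN / n) * Real.exp δ * B := by
            have e1 : |u x' - u x| = |(n : ℝ) * (u x' - u x)| / n := by
              rw [abs_mul, abs_of_pos hn0, mul_div_cancel_left₀ _ (ne_of_gt hn0)]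
            rw [e1, div_le_iff₀ hn0]
            refine hdu.trans (le_of_eq ?_)
            rw [← hDform]
            field_simp
          calc W * (|(n : ℝ) * (chi n M M0 s x'.1 - chi n M M0 s xe'.1)| * |u x' - u x|)
              ≤ W * (8 * (((d : ℝ) + 1) * (sN / n) * Real.exp δ * B)) :=
                mul_le_mul_of_nonneg_left (mul_le_mul hχb hdu' (abs_nonneg _) (by norm_num)) hW0
            _ = 8 * (((d : ℝ) + 1) * Real.exp δ * B) * (W * (sN / n)) := by ring
            _ ≤ 8 * (((d : ℝ) + 1) * Real.exp δ * B) * 1 := mul_le_mul_of_nonneg_left hWs (by positivity)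
            _ = 8 * (((d : ℝ) + 1) * Real.exp δ * B) := mul_one _
        -- (iv) Lipschitz of the bond derivative of `χ` times `u(x)`
        have hIV : W * (|(n : ℝ) * (chi n M M0 s x'.1 - chi n M M0 s xe'.1)
              - (n : ℝ) * (chi n M M0 s x.1 - chi n M M0 s xe.1)| * |u x|) ≤ 128 * (((d : ℝ) + 1) * B) := by
          have hv := value_pt hn1 hs hδ G hS0 f hF x hDx hDbx hDf hbd hx0
          rw [← hu, hBform] at hv
          have hL : |(n : ℝ) * (chi n M M0 s x'.1 - chi n M M0 s xe'.1)
              - (n : ℝ) * (chi n M M0 s x.1 - chi n M M0 s xe.1)| ≤ 128 * ((d : ℝ) + 1) * sN / n := by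
            have h := abs_dchi_sub_le M M0 s hn1 μ x.2 xe.2 x'.2 xe'.2 hxe hxe'
            rw [← hsN] at h
            rw [show (n : ℝ) * (chi n M M0 s x'.1 - chi n M M0 s xe'.1) - (n : ℝ) * (chi n M M0 s x.1 - chi n M M0 s xe.1)
              = -((n : ℝ) * (chi n M M0 s xe'.1 - chi n M M0 s x'.1)
                  - (n : ℝ) * (chi n M M0 s xe.1 - chi n M M0 s x.1)) by ring, abs_neg]
            exact h
          calc W * (|(n : ℝ) * (chi n M M0 s x'.1 - chi n M M0 s xe'.1)
                - (n : ℝ) * (chi n M M0 s x.1 - chi n M M0 s xe.1)| * |u x|)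
              ≤ W * (128 * ((d : ℝ) + 1) * sN / n * B) :=
                mul_le_mul_of_nonneg_left (mul_le_mul hL hv (abs_nonneg _)
                  (div_nonneg (mul_nonneg (by positivity) hs0.le) hn0.le)) hW0
            _ = 128 * (((d : ℝ) + 1) * B) * (W * (sN / n)) := by ring
            _ ≤ 128 * (((d : ℝ) + 1) * B) * 1 := mul_le_mul_of_nonneg_left hWs (by positivity)
            _ = 128 * (((d : ℝ) + 1) * B) := mul_one _
        -- the discrete product rule and the sum
        have e : (n : ℝ) * (((1 - chi n M M0 s xe'.1) * u xe' - (1 - chi n M M0 s x'.1) * u x')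
              - ((1 - chi n M M0 s xe.1) * u xe - (1 - chi n M M0 s x.1) * u x))
            = (1 - chi n M M0 s xe'.1) * ((n : ℝ) * ((u xe' - u x') - (u xe - u x)))
              + (chi n M M0 s xe.1 - chi n M M0 s xe'.1) * ((n : ℝ) * (u xe - u x))
              + (n : ℝ) * (chi n M M0 s x'.1 - chi n M M0 s xe'.1) * (u x' - u x)
              + ((n : ℝ) * (chi n M M0 s x'.1 - chi n M M0 s xe'.1)
                  - (n : ℝ) * (chi n M M0 s x.1 - chi n M M0 s xe.1)) * u x := by ring
        rw [e]
        have he1 : 1 ≤ Real.exp δ := Real.one_le_exp hδ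
        have hde : 1 ≤ ((d : ℝ) + 1) * Real.exp δ := by
          calc (1 : ℝ) = 1 * 1 := (one_mul 1).symm
            _ ≤ ((d : ℝ) + 1) * Real.exp δ := mul_le_mul hd1 he1 zero_le_one (by positivity)
        have hdB : B ≤ ((d : ℝ) + 1) * Real.exp δ * B := by
          calc B = 1 * B := (one_mul B).symm
            _ ≤ ((d : ℝ) + 1) * Real.exp δ * B := mul_le_mul_of_nonneg_right hde hB0
        have hdB' : ((d : ℝ) + 1) * B ≤ ((d : ℝ) + 1) * Real.exp δ * B := by
          calc ((d : ℝ) + 1) * B = ((d : ℝ) + 1) * 1 * B := by ring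
            _ ≤ ((d : ℝ) + 1) * Real.exp δ * B :=
                mul_le_mul_of_nonneg_right (mul_le_mul_of_nonneg_left he1 (by positivity)) hB0
        calc W * |(1 - chi n M M0 s xe'.1) * ((n : ℝ) * ((u xe' - u x') - (u xe - u x)))
              + (chi n M M0 s xe.1 - chi n M M0 s xe'.1) * ((n : ℝ) * (u xe - u x))
              + (n : ℝ) * (chi n M M0 s x'.1 - chi n M M0 s xe'.1) * (u x' - u x)
              + ((n : ℝ) * (chi n M M0 s x'.1 - chi n M M0 s xe'.1)
                  - (n : ℝ) * (chi n M M0 s x.1 - chi n M M0 s xe.1)) * u x|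
            ≤ W * (|1 - chi n M M0 s xe'.1| * |(n : ℝ) * ((u xe' - u x') - (u xe - u x))|
              + |chi n M M0 s xe.1 - chi n M M0 s xe'.1| * |(n : ℝ) * (u xe - u x)|
              + |(n : ℝ) * (chi n M M0 s x'.1 - chi n M M0 s xe'.1)| * |u x' - u x|
              + |(n : ℝ) * (chi n M M0 s x'.1 - chi n M M0 s xe'.1)
                  - (n : ℝ) * (chi n M M0 s x.1 - chi n M M0 s xe.1)| * |u x|) := by
              refine mul_le_mul_of_nonneg_left ?_ hW0
              rw [← abs_mul, ← abs_mul, ← abs_mul, ← abs_mul]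
              exact (abs_add_le _ _).trans (add_le_add ((abs_add_three _ _ _)) le_rfl)
          _ ≤ W * (1 * |(n : ℝ) * ((u xe' - u x') - (u xe - u x))|)
              + W * (|chi n M M0 s xe.1 - chi n M M0 s xe'.1| * |(n : ℝ) * (u xe - u x)|)
              + W * (|(n : ℝ) * (chi n M M0 s x'.1 - chi n M M0 s xe'.1)| * |u x' - u x|)
              + W * (|(n : ℝ) * (chi n M M0 s x'.1 - chi n M M0 s xe'.1)
                  - (n : ℝ) * (chi n M M0 s x.1 - chi n M M0 s xe.1)| * |u x|) := by
              rw [mul_add, mul_add, mul_add]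
              refine add_le_add (add_le_add (add_le_add ?_ le_rfl) le_rfl) le_rfl
              exact mul_le_mul_of_nonneg_left (mul_le_mul_of_nonneg_right
                (abs_one_sub_chi_le_one n M M0 s xe'.1) (abs_nonneg _)) hW0
          _ ≤ B + 8 * (((d : ℝ) + 1) * B) + 8 * (((d : ℝ) + 1) * Real.exp δ * B) + 128 * (((d : ℝ) + 1) * B) := by
              rw [one_mul]
              exact add_le_add (add_le_add (add_le_add hI hII) hIII) hIV
          _ ≤ ((d : ℝ) + 1) * Real.exp δ * B + 8 * (((d : ℝ) + 1) * Real.exp δ * B)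
              + 8 * (((d : ℝ) + 1) * Real.exp δ * B) + 128 * (((d : ℝ) + 1) * Real.exp δ * B) := by
              refine add_le_add (add_le_add (add_le_add hdB ?_) le_rfl) ?_
              · exact mul_le_mul_of_nonneg_left hdB' (by norm_num)
              · exact mul_le_mul_of_nonneg_left hdB' (by norm_num)
          _ = 145 * (((d : ℝ) + 1) * Real.exp δ * B) := by ring
      · -- off the collar all four cut factors vanish
        rw [chi_eq_one_of_not_bd hn hs hM hx0 hbd, chi_eq_one_of_not_bd hn hs hM hxxe hbd,
          chi_eq_one_of_not_bd hn hs hM hxx' hbd, chi_eq_one_of_not_bd hn hs hM hxxe' hbd]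
        simp only [sub_self, zero_mul, mul_zero, abs_zero]
        exact mul_nonneg (by norm_num) (mul_nonneg (mul_nonneg (by positivity) (Real.exp_pos _).le) hB0)
    ------------------------------------------------------------------
    -- T2: the cut source through `G₀`
    ------------------------------------------------------------------
    have hexe : (emb (hs.scale n) xe).1 = (emb (hs.scale n) x).1 + Pi.single μ 1 := emb_bond hs hxe
    have hexe' : (emb (hs.scale n) xe').1 = (emb (hs.scale n) x').1 + Pi.single μ 1 := emb_bond hs hxe'
    have hene : (emb (hs.scale n) x').1 ≠ (emb (hs.scale n) x).1 := emb_ne hs hne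
    have hWe : ((n : ℝ) / supNorm ((emb (hs.scale n) x').1 - (emb (hs.scale n) x).1)) ^ α = W := by
      rw [emb_sub_emb hs, ← hsN, hW]
    have hexx' : supNorm ((emb (hs.scale n) x).1 - (emb (hs.scale n) x').1) ≤ n := by
      rw [emb_sub_emb hs]; exact hxx'
    have hT2 : W * |(n : ℝ) * (((G0 *ᵥ ext n M M0 s (fun z => (1 - chi n M M0 s z.1) * f z)) (emb (hs.scale n) xe')
            - (G0 *ᵥ ext n M M0 s (fun z => (1 - chi n M M0 s z.1) * f z)) (emb (hs.scale n) x'))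
          - ((G0 *ᵥ ext n M M0 s (fun z => (1 - chi n M M0 s z.1) * f z)) (emb (hs.scale n) xe)
            - (G0 *ᵥ ext n M M0 s (fun z => (1 - chi n M M0 s z.1) * f z)) (emb (hs.scale n) x)))|
        ≤ c * (Real.exp δ * (Real.exp δ * P)) := by
      rw [← abs_of_nonneg hW0, ← abs_mul, mulVec_dd]
      have hg := hR2 μ (emb (hs.scale n) x) (emb (hs.scale n) xe) (emb (hs.scale n) x') (emb (hs.scale n) xe')
        hexe hexe' hene
      rw [hWe] at hg
      refine abs_sum_mul_le_of_weight2 hδ (emb (hs.scale n) x) (emb (hs.scale n) x') hexx' _ _ hg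
        (mul_nonneg (Real.exp_pos _).le hP0) fun y => ?_
      exact ext_weight_bound hs (mul_nonneg (Real.exp_pos δ).le hP0) (fun z => (1 - chi n M M0 s z.1) * f z) x
        (fun z => by have h := cutf_pt hn hs hM hδ f hF x hDx hDbx hDf z; rw [hP]; rw [mul_assoc] at h; exact h) y
    ------------------------------------------------------------------
    -- T3: the commutator source through `G₀`
    ------------------------------------------------------------------
    have hK : 0 ≤ (80 * ((d : ℝ) + 1) + Ab) * c := mul_nonneg (add_nonneg (by positivity) hAb0) hc
    have hT3 : W * |(n : ℝ) * (((G0 *ᵥ ext n M M0 s (comm n A m2 M (fun z' => chi n M M0 s z'.1) u)) (emb (hs.scale n) xe')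
            - (G0 *ᵥ ext n M M0 s (comm n A m2 M (fun z' => chi n M M0 s z'.1) u)) (emb (hs.scale n) x'))
          - ((G0 *ᵥ ext n M M0 s (comm n A m2 M (fun z' => chi n M M0 s z'.1) u)) (emb (hs.scale n) xe)
            - (G0 *ᵥ ext n M M0 s (comm n A m2 M (fun z' => chi n M M0 s z'.1) u)) (emb (hs.scale n) x)))|
        ≤ c * (Real.exp δ * ((80 * ((d : ℝ) + 1) + Ab) * c * Real.exp (3 * δ) * P)) := by
      rw [← abs_of_nonneg hW0, ← abs_mul, mulVec_dd]
      have hg := hR2 μ (emb (hs.scale n) x) (emb (hs.scale n) xe) (emb (hs.scale n) x') (emb (hs.scale n) xe')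
        hexe hexe' hene
      rw [hWe] at hg
      refine abs_sum_mul_le_of_weight2 hδ (emb (hs.scale n) x) (emb (hs.scale n) x') hexx' _ _ hg
        (mul_nonneg (mul_nonneg hK (Real.exp_pos _).le) hP0) fun y => ?_
      refine ext_weight_bound hs (mul_nonneg (mul_nonneg hK (Real.exp_pos _).le) hP0) _ x (fun z => ?_) y
      have h := comm_pt (m2 := m2) hn hs hM hA.le hAb hδ hc G hS0 hS1 f hF x hDx hDbx hDf z
      rw [← hu] at h
      rw [hP]
      calc |comm n A m2 M (fun z' => chi n M M0 s z'.1) u z|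
          ≤ Real.exp (δ * supNorm (x.1 - z.1) / n) *
            ((80 * ((d : ℝ) + 1) + Ab) * c * Real.exp (3 * δ) * dfac (δ / 2) n D Db Df * F) := h
        _ = _ := by ring
    ------------------------------------------------------------------
    -- assembly
    ------------------------------------------------------------------
    set a1' := (1 - chi n M M0 s xe'.1) * u xe' with ha1'
    set a0' := (1 - chi n M M0 s x'.1) * u x' with ha0'
    set a1 := (1 - chi n M M0 s xe.1) * u xe with ha1
    set a0 := (1 - chi n M M0 s x.1) * u x with ha0
    set b1' := (G0 *ᵥ ext n M M0 s (fun z => (1 - chi n M M0 s z.1) * f z)) (emb (hs.scale n) xe') with hb1'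
    set b0' := (G0 *ᵥ ext n M M0 s (fun z => (1 - chi n M M0 s z.1) * f z)) (emb (hs.scale n) x') with hb0'
    set b1 := (G0 *ᵥ ext n M M0 s (fun z => (1 - chi n M M0 s z.1) * f z)) (emb (hs.scale n) xe) with hb1
    set b0 := (G0 *ᵥ ext n M M0 s (fun z => (1 - chi n M M0 s z.1) * f z)) (emb (hs.scale n) x) with hb0
    set c1' := (G0 *ᵥ ext n M M0 s (comm n A m2 M (fun z' => chi n M M0 s z'.1) u)) (emb (hs.scale n) xe') with hc1'
    set c0' := (G0 *ᵥ ext n M M0 s (comm n A m2 M (fun z' => chi n M M0 s z'.1) u)) (emb (hs.scale n) x') with hc0'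
    set c1 := (G0 *ᵥ ext n M M0 s (comm n A m2 M (fun z' => chi n M M0 s z'.1) u)) (emb (hs.scale n) xe) with hc1
    set c0 := (G0 *ᵥ ext n M M0 s (comm n A m2 M (fun z' => chi n M M0 s z'.1) u)) (emb (hs.scale n) x) with hc0
    have e : (n : ℝ) * ((a1' - b1' + c1' - (a0' - b0' + c0')) - (a1 - b1 + c1 - (a0 - b0 + c0)))
        = (n : ℝ) * ((a1' - a0') - (a1 - a0)) - (n : ℝ) * ((b1' - b0') - (b1 - b0))
          + (n : ℝ) * ((c1' - c0') - (c1 - c0)) := by ring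
    rw [e]
    have he1 : Real.exp δ ≤ Real.exp (4 * δ) := Real.exp_le_exp.2 (by linarith)
    have he2 : Real.exp δ * Real.exp δ ≤ Real.exp (4 * δ) := by
      rw [← Real.exp_add]; exact Real.exp_le_exp.2 (by linarith)
    have he4 : Real.exp δ * Real.exp (3 * δ) = Real.exp (4 * δ) := by rw [← Real.exp_add]; ring_nf
    calc W * |(n : ℝ) * ((a1' - a0') - (a1 - a0)) - (n : ℝ) * ((b1' - b0') - (b1 - b0))
          + (n : ℝ) * ((c1' - c0') - (c1 - c0))|
        ≤ W * (|(n : ℝ) * ((a1' - a0') - (a1 - a0))| + |(n : ℝ) * ((b1' - b0') - (b1 - b0))|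
          + |(n : ℝ) * ((c1' - c0') - (c1 - c0))|) := by
          refine mul_le_mul_of_nonneg_left ?_ hW0
          exact (abs_add_le _ _).trans (add_le_add (abs_sub _ _) le_rfl)
      _ = W * |(n : ℝ) * ((a1' - a0') - (a1 - a0))| + W * |(n : ℝ) * ((b1' - b0') - (b1 - b0))|
          + W * |(n : ℝ) * ((c1' - c0') - (c1 - c0))| := by ring
      _ ≤ 145 * (((d : ℝ) + 1) * Real.exp δ * B) + c * (Real.exp δ * (Real.exp δ * P))
          + c * (Real.exp δ * ((80 * ((d : ℝ) + 1) + Ab) * c * Real.exp (3 * δ) * P)) :=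
          add_le_add (add_le_add hT1 hT2) hT3
      _ = c * Real.exp (4 * δ) * (145 * ((d : ℝ) + 1)) * P + c * (Real.exp δ * Real.exp δ) * P
          + c * Real.exp (4 * δ) * ((80 * ((d : ℝ) + 1) + Ab) * c) * P := by
          rw [hB, ← he4]; ring
      _ ≤ c * Real.exp (4 * δ) * (145 * ((d : ℝ) + 1)) * P + c * Real.exp (4 * δ) * P
          + c * Real.exp (4 * δ) * ((80 * ((d : ℝ) + 1) + Ab) * c) * P := by
          refine add_le_add (add_le_add le_rfl ?_) le_rfl
          exact mul_le_mul_of_nonneg_right (mul_le_mul_of_nonneg_left he2 hc) hP0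
      _ = c * Real.exp (4 * δ) * (145 * ((d : ℝ) + 1) + 1 + (80 * ((d : ℝ) + 1) + Ab) * c) * P := by ring
      _ ≤ cH d Ab δ c * P := mul_le_mul_of_nonneg_right (near_le_cH d hAb0 hc) hP0
      _ = cH d Ab δ c * dfac (δ / 2) n D Db Df * F := by rw [hP]; ring

end Core

/-! ## §5 B4 (1.9)·(1.12) for `δG_k(Ω, Ω₀, 0)` on nested block-aligned boxes: the Hölder clause -/

section Final

/-- **MERGING THE THREE FAMILIES OF ROW BOUNDS AT `A = 0`** (values: node 6; differences: node 7; two-centre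
Hölder rows: node 10) at one rate `δ = min` and one height `c = max`, for a coefficient `coef a k` of `P_k`.
[folklore] -/
theorem bounds_common3 {d ℓ : ℕ} {amin aplus m2plus : ℝ} (coef : ℝ → ℕ → ℝ) {α : ℝ}
    (h6 : ∃ δ₀ c₀ : ℝ, 0 < δ₀ ∧ 0 < c₀ ∧ ∀ (k : ℕ), 1 ≤ k → ∀ (a m2 : ℝ), amin ≤ a → a ≤ aplus → 0 ≤ m2 →
      m2 ≤ m2plus → ∀ (M : Fin (d + 1) → ℕ), (∀ i, 1 ≤ M i) →
        ∀ x : ↥(boxDom (fun i => (ℓ + 1) ^ k * M i)),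
          ∑ x', |(boxOpR ((ℓ + 1) ^ k) (coef a k) m2 M)⁻¹ x x'|
              * Real.exp (δ₀ * supNorm (x.1 - x'.1) / (((ℓ + 1) ^ k : ℕ) : ℝ)) ≤ c₀)
    (h7 : ∃ δ₀ c₀ : ℝ, 0 < δ₀ ∧ 0 < c₀ ∧ ∀ (k : ℕ), 1 ≤ k → ∀ (a m2 : ℝ), amin ≤ a → a ≤ aplus → 0 ≤ m2 →
      m2 ≤ m2plus → ∀ (M : Fin (d + 1) → ℕ), (∀ i, 1 ≤ M i) →
        ∀ (μ : Fin (d + 1)) (x xe : ↥(boxDom (fun i => (ℓ + 1) ^ k * M i))), xe.1 = x.1 + Pi.single μ 1 →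
          ∑ x', |(((ℓ + 1) ^ k : ℕ) : ℝ) *
                ((boxOpR ((ℓ + 1) ^ k) (coef a k) m2 M)⁻¹ xe x' - (boxOpR ((ℓ + 1) ^ k) (coef a k) m2 M)⁻¹ x x')|
              * Real.exp (δ₀ * supNorm (x.1 - x'.1) / (((ℓ + 1) ^ k : ℕ) : ℝ)) ≤ c₀)
    (h10 : ∃ δ₀ c₀ : ℝ, 0 < δ₀ ∧ 0 < c₀ ∧ ∀ (k : ℕ), 1 ≤ k → ∀ (a m2 : ℝ), amin ≤ a → a ≤ aplus → 0 ≤ m2 →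
      m2 ≤ m2plus → ∀ (M : Fin (d + 1) → ℕ), (∀ i, 1 ≤ M i) →
        ∀ (μ : Fin (d + 1)) (x xe x' xe' : ↥(boxDom (fun i => (ℓ + 1) ^ k * M i))),
          xe.1 = x.1 + Pi.single μ 1 → xe'.1 = x'.1 + Pi.single μ 1 → x'.1 ≠ x.1 →
          ∑ z, |((((ℓ + 1) ^ k : ℕ) : ℝ) / supNorm (x'.1 - x.1)) ^ α * ((((ℓ + 1) ^ k : ℕ) : ℝ) *
                (((boxOpR ((ℓ + 1) ^ k) (coef a k) m2 M)⁻¹ xe' z - (boxOpR ((ℓ + 1) ^ k) (coef a k) m2 M)⁻¹ x' z)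
                  - ((boxOpR ((ℓ + 1) ^ k) (coef a k) m2 M)⁻¹ xe z - (boxOpR ((ℓ + 1) ^ k) (coef a k) m2 M)⁻¹ x z)))|
              * Real.exp (δ₀ * min (supNorm (x.1 - z.1)) (supNorm (x'.1 - z.1)) / (((ℓ + 1) ^ k : ℕ) : ℝ))
            ≤ c₀) :
    ∃ δ c : ℝ, 0 < δ ∧ 0 < c ∧ ∀ (k : ℕ), 1 ≤ k → ∀ (a m2 : ℝ), amin ≤ a → a ≤ aplus → 0 ≤ m2 → m2 ≤ m2plus →
      ∀ (M : Fin (d + 1) → ℕ), (∀ i, 1 ≤ M i) →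
        (∀ x : ↥(boxDom (fun i => (ℓ + 1) ^ k * M i)),
          roww δ ((ℓ + 1) ^ k) (boxOpR ((ℓ + 1) ^ k) (coef a k) m2 M)⁻¹ x ≤ c) ∧
        (∀ (μ : Fin (d + 1)) (x xe : ↥(boxDom (fun i => (ℓ + 1) ^ k * M i))), xe.1 = x.1 + Pi.single μ 1 →
          wsum δ ((ℓ + 1) ^ k) x (fun x' => (((ℓ + 1) ^ k : ℕ) : ℝ) *
            ((boxOpR ((ℓ + 1) ^ k) (coef a k) m2 M)⁻¹ xe x' - (boxOpR ((ℓ + 1) ^ k) (coef a k) m2 M)⁻¹ x x')) ≤ c) ∧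
        (∀ (μ : Fin (d + 1)) (x xe x' xe' : ↥(boxDom (fun i => (ℓ + 1) ^ k * M i))),
          xe.1 = x.1 + Pi.single μ 1 → xe'.1 = x'.1 + Pi.single μ 1 → x'.1 ≠ x.1 →
          wsum2 δ ((ℓ + 1) ^ k) x x' (fun z => ((((ℓ + 1) ^ k : ℕ) : ℝ) / supNorm (x'.1 - x.1)) ^ α *
            ((((ℓ + 1) ^ k : ℕ) : ℝ) *
              (((boxOpR ((ℓ + 1) ^ k) (coef a k) m2 M)⁻¹ xe' z - (boxOpR ((ℓ + 1) ^ k) (coef a k) m2 M)⁻¹ x' z)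
                - ((boxOpR ((ℓ + 1) ^ k) (coef a k) m2 M)⁻¹ xe z - (boxOpR ((ℓ + 1) ^ k) (coef a k) m2 M)⁻¹ x z))))
            ≤ c) := by
  obtain ⟨δ₁, c₁, hδ1, hc1, H1⟩ := bounds_common coef h6 h7
  obtain ⟨δ₂, c₂, hδ2, hc2, H2⟩ := h10
  refine ⟨min δ₁ δ₂, max c₁ c₂, lt_min hδ1 hδ2, lt_max_iff.2 (Or.inl hc1), ?_⟩
  intro k hk a m2 h1 h2 h3 h4 M hM
  obtain ⟨HS0, HS1⟩ := H1 k hk a m2 h1 h2 h3 h4 M hM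
  refine ⟨fun x => ?_, fun μ x xe hxe => ?_, fun μ x xe x' xe' hxe hxe' hne => ?_⟩
  · exact ((roww_rate_mono (min_le_left _ _) _ _ _).trans (HS0 x)).trans (le_max_left _ _)
  · exact ((wsum_rate_mono (min_le_left _ _) _ _ _).trans (HS1 μ x xe hxe)).trans (le_max_left _ _)
  · refine ((wsum2_mono_rate (min_le_right _ _) _ _ _ _).trans ?_).trans (le_max_right _ _)
    have := H2 k hk a m2 h1 h2 h3 h4 M hM μ x xe x' xe' hxe hxe' hne
    unfold wsum2
    exact this

/-- **THE ENGINE**: the Hölder clause for `δG` from the merged row bounds, for any admissible coefficient.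
[folklore] -/
theorem delta112_holder_of_bounds {d ℓ : ℕ} (hℓ : 1 ≤ ℓ) {amin aplus m2plus Ab : ℝ} (coef : ℝ → ℕ → ℝ)
    (hcoef : ∀ (k : ℕ), 1 ≤ k → ∀ a, amin ≤ a → a ≤ aplus → 0 < coef a k ∧ coef a k ≤ Ab)
    {δ c α : ℝ} (hδ : 0 < δ) (hc : 0 < c) (hα0 : 0 ≤ α) (hα1 : α ≤ 1)
    (H : ∀ (k : ℕ), 1 ≤ k → ∀ (a m2 : ℝ), amin ≤ a → a ≤ aplus → 0 ≤ m2 → m2 ≤ m2plus →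
      ∀ (M : Fin (d + 1) → ℕ), (∀ i, 1 ≤ M i) →
        (∀ x : ↥(boxDom (fun i => (ℓ + 1) ^ k * M i)),
          roww δ ((ℓ + 1) ^ k) (boxOpR ((ℓ + 1) ^ k) (coef a k) m2 M)⁻¹ x ≤ c) ∧
        (∀ (μ : Fin (d + 1)) (x xe : ↥(boxDom (fun i => (ℓ + 1) ^ k * M i))), xe.1 = x.1 + Pi.single μ 1 →
          wsum δ ((ℓ + 1) ^ k) x (fun x' => (((ℓ + 1) ^ k : ℕ) : ℝ) *
            ((boxOpR ((ℓ + 1) ^ k) (coef a k) m2 M)⁻¹ xe x' - (boxOpR ((ℓ + 1) ^ k) (coef a k) m2 M)⁻¹ x x')) ≤ c) ∧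
        (∀ (μ : Fin (d + 1)) (x xe x' xe' : ↥(boxDom (fun i => (ℓ + 1) ^ k * M i))),
          xe.1 = x.1 + Pi.single μ 1 → xe'.1 = x'.1 + Pi.single μ 1 → x'.1 ≠ x.1 →
          wsum2 δ ((ℓ + 1) ^ k) x x' (fun z => ((((ℓ + 1) ^ k : ℕ) : ℝ) / supNorm (x'.1 - x.1)) ^ α *
            ((((ℓ + 1) ^ k : ℕ) : ℝ) *
              (((boxOpR ((ℓ + 1) ^ k) (coef a k) m2 M)⁻¹ xe' z - (boxOpR ((ℓ + 1) ^ k) (coef a k) m2 M)⁻¹ x' z)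
                - ((boxOpR ((ℓ + 1) ^ k) (coef a k) m2 M)⁻¹ xe z - (boxOpR ((ℓ + 1) ^ k) (coef a k) m2 M)⁻¹ x z))))
            ≤ c)) :
    ∀ (k : ℕ), 1 ≤ k → ∀ (a m2 : ℝ), amin ≤ a → a ≤ aplus → 0 ≤ m2 →
      m2 ≤ m2plus → ∀ (M M0 : Fin (d + 1) → ℕ) (s : Fin (d + 1) → ℤ) (hs : Fits M M0 s), (∀ i, 1 ≤ M i) →
      ∀ (f : ↥(boxDom (fun i => (ℓ + 1) ^ k * M i)) → ℝ) (F : ℝ), (∀ z, |f z| ≤ F) →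
      ∀ (μ : Fin (d + 1)) (x xe x' xe' : ↥(boxDom (fun i => (ℓ + 1) ^ k * M i))),
        xe.1 = x.1 + Pi.single μ 1 → xe'.1 = x'.1 + Pi.single μ 1 → x'.1 ≠ x.1 →
      ∀ (D Db Df : ℝ),
        (∀ z, f z ≠ 0 → D ≤ min (supNorm (x.1 - z.1)) (supNorm (x'.1 - z.1))) →
        (∀ y : ↥(boxDom (fun i => (ℓ + 1) ^ k * M0 i)),
          (y.1 - fun i => ((((ℓ + 1) ^ k : ℕ) : ℤ)) * s i) ∉ boxDom (fun i => (ℓ + 1) ^ k * M i) →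
            Db ≤ min (supNorm ((emb (hs.scale ((ℓ + 1) ^ k)) x).1 - y.1))
              (supNorm ((emb (hs.scale ((ℓ + 1) ^ k)) x').1 - y.1))) →
        (∀ z, f z ≠ 0 → ∀ y : ↥(boxDom (fun i => (ℓ + 1) ^ k * M0 i)),
          (y.1 - fun i => ((((ℓ + 1) ^ k : ℕ) : ℤ)) * s i) ∉ boxDom (fun i => (ℓ + 1) ^ k * M i) →
            Df ≤ supNorm ((emb (hs.scale ((ℓ + 1) ^ k)) z).1 - y.1)) →
        ((((ℓ + 1) ^ k : ℕ) : ℝ) / supNorm (x'.1 - x.1)) ^ α *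
          |(((ℓ + 1) ^ k : ℕ) : ℝ) * ((dG ((ℓ + 1) ^ k) (coef a k) m2 hs f xe' - dG ((ℓ + 1) ^ k) (coef a k) m2 hs f x')
            - (dG ((ℓ + 1) ^ k) (coef a k) m2 hs f xe - dG ((ℓ + 1) ^ k) (coef a k) m2 hs f x))|
          ≤ cH d Ab δ c * dfac (δ / 2) ((ℓ + 1) ^ k) D Db Df * F := by
  intro k hk a m2 h1 h2 h3 h4 M M0 s hs hM f F hF μ x xe x' xe' hxe hxe' hne D Db Df hD hDb hDf
  have hn : 2 ≤ (ℓ + 1) ^ k := two_le_pow hℓ hk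
  obtain ⟨hA0, hA2⟩ := hcoef k hk a h1 h2
  have hM0 : ∀ i, 1 ≤ M0 i := hs.one_le hM
  obtain ⟨hS0, hS1, hS2⟩ := H k hk a m2 h1 h2 h3 h4 M hM
  obtain ⟨-, hR1, hR2⟩ := H k hk a m2 h1 h2 h3 h4 M0 hM0
  exact core_holder hn hs hM hA0 hA2 h3 hδ.le hc.le hα0 hα1 hS0 hS1 hS2 hR1 hR2 f hF μ x xe x' xe' hxe hxe' hne
    hD hDb hDf

/-- **B4 (1.9)·(1.12) FOR `δG_k(Ω, Ω₀, 0)`, NESTED BLOCK-ALIGNED BOXES — THE HÖLDER CLAUSE.**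
There are `δ₀ > 0`, `c₀ > 0` depending only on `d`, `L = ℓ + 1`, the window and `α ∈ [0, 1)` such that for every
`k ≥ 1` (`η = L^{-k}`, `n = L^k` fine points per unit length), every `(a, m²)` in the window, every nested pair of
block-aligned rectangular parallelepipeds `Ω = s + Π_μ[0, M_μ) ⊂ Ω₀ = Π_μ[0, M₀_μ)` (`M_μ ≥ 1`, integer corners), every
function `f` on the fine points of `Ω` with `|f| ≤ F`, every axis `μ`, all fine points `x ≠ x′` of `Ω` with
`x + ηe_μ, x′ + ηe_μ ∈ Ω`, and all `D, D_b, D_f` with `D ≤ |{x,x′} − supp f|_∞`, `D_b ≤ |{x,x′} − (Ω₀∖Ω)|_∞`,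
`D_f ≤ |supp f − (Ω₀∖Ω)|_∞` (fine-lattice sup-distances):
`(n/|x − x′|_∞)^α · |η^{-1}((δG f)(x′ + ηe_μ) − (δG f)(x′)) − η^{-1}((δG f)(x + ηe_μ) − (δG f)(x))|`
`≤ c₀ · e^{−δ₀D/n} · e^{−δ₀D_b/n − δ₀D_f/n} · F`, `δG = δG_k(Ω, Ω₀, 0)` of (1.11) (`= G_k(Ω,0)f − (G_k(Ω₀,0)Ef)|_Ω`),
`G_k(·, 0) = (−Δ^{η,N} + m² + a_kP_k)^{-1}`; i.e. the Hölder quotient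
`|(D^η_0 δGf)(x) − (D^η_0 δGf)(x′)| / |x − x′|^α` of (1.9) (covariant derivative (1.3) at `A = 0`, `U ≡ 1`) obeys the
bound (1.9) «multiplied by `exp(−δ₀dist({x,x′}, Ω^c) − δ₀dist(supp f, Ω^c))`» (1.12) in the typed reading (D-b04.2),
for boxes («if `Ω` is a rectangular parallelepiped … the restriction `dist({x,x′}, Ω^c) ≥ R₀` is unnecessary»,
p. 579).  HONEST LABEL: proved here, at `A = 0` and for block-aligned boxes only, by the smooth-cutoff commutator
argument of node `B4Delta112ZeroBox` over the kernel bounds of nodes `B4Thm110ZeroBox` / `B4Thm110ZeroBoxDeriv` /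
`B4Thm19ZeroBoxHolder` — not a transcription of the print's random-walk proof (p. 579); `α = 1` is covered by the
core estimate but the row bound of node 10 is stated for `α < 1` as printed.
[cite: Balaban1983RegularityDecay, p. 573 Theorem (Prop. 2.1 of [1]) (1.9), (1.11)–(1.12); p. 579] -/
theorem delta112_zero_box_holder (d ℓ : ℕ) (hℓ : 1 ≤ ℓ) (amin aplus m2plus : ℝ) (ha : 0 < amin) (α : ℝ)
    (hα0 : 0 ≤ α) (hα1 : α < 1) :
    ∃ δ₀ c₀ : ℝ, 0 < δ₀ ∧ 0 < c₀ ∧ ∀ (k : ℕ), 1 ≤ k → ∀ (a m2 : ℝ), amin ≤ a → a ≤ aplus → 0 ≤ m2 →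
      m2 ≤ m2plus → ∀ (M M0 : Fin (d + 1) → ℕ) (s : Fin (d + 1) → ℤ) (hs : Fits M M0 s), (∀ i, 1 ≤ M i) →
      ∀ (f : ↥(boxDom (fun i => (ℓ + 1) ^ k * M i)) → ℝ) (F : ℝ), (∀ z, |f z| ≤ F) →
      ∀ (μ : Fin (d + 1)) (x xe x' xe' : ↥(boxDom (fun i => (ℓ + 1) ^ k * M i))),
        xe.1 = x.1 + Pi.single μ 1 → xe'.1 = x'.1 + Pi.single μ 1 → x'.1 ≠ x.1 →
      ∀ (D Db Df : ℝ),
        (∀ z, f z ≠ 0 → D ≤ min (supNorm (x.1 - z.1)) (supNorm (x'.1 - z.1))) →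
        (∀ y : ↥(boxDom (fun i => (ℓ + 1) ^ k * M0 i)),
          (y.1 - fun i => ((((ℓ + 1) ^ k : ℕ) : ℤ)) * s i) ∉ boxDom (fun i => (ℓ + 1) ^ k * M i) →
            Db ≤ min (supNorm ((emb (hs.scale ((ℓ + 1) ^ k)) x).1 - y.1))
              (supNorm ((emb (hs.scale ((ℓ + 1) ^ k)) x').1 - y.1))) →
        (∀ z, f z ≠ 0 → ∀ y : ↥(boxDom (fun i => (ℓ + 1) ^ k * M0 i)),
          (y.1 - fun i => ((((ℓ + 1) ^ k : ℕ) : ℤ)) * s i) ∉ boxDom (fun i => (ℓ + 1) ^ k * M i) →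
            Df ≤ supNorm ((emb (hs.scale ((ℓ + 1) ^ k)) z).1 - y.1)) →
        ((((ℓ + 1) ^ k : ℕ) : ℝ) / supNorm (x'.1 - x.1)) ^ α *
          |(((ℓ + 1) ^ k : ℕ) : ℝ) *
            ((dG ((ℓ + 1) ^ k) (B1.aSeq a ((ℓ : ℝ) + 1) k) m2 hs f xe' - dG ((ℓ + 1) ^ k) (B1.aSeq a ((ℓ : ℝ) + 1) k) m2 hs f x')
              - (dG ((ℓ + 1) ^ k) (B1.aSeq a ((ℓ : ℝ) + 1) k) m2 hs f xe - dG ((ℓ + 1) ^ k) (B1.aSeq a ((ℓ : ℝ) + 1) k) m2 hs f x))|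
          ≤ c₀ * Real.exp (-(δ₀ * D / (((ℓ + 1) ^ k : ℕ) : ℝ)))
              * Real.exp (-(δ₀ * Db / (((ℓ + 1) ^ k : ℕ) : ℝ) + δ₀ * Df / (((ℓ + 1) ^ k : ℕ) : ℝ))) * F := by
  obtain ⟨δ, c, hδ, hc, H⟩ := bounds_common3 (fun a k => B1.aSeq a ((ℓ : ℝ) + 1) k)
    (thm110_zero_box_roww d ℓ hℓ amin aplus m2plus ha) (thm110_zero_box_deriv_roww d ℓ hℓ amin aplus m2plus ha)
    (thm19_zero_box_holder_roww d ℓ hℓ amin aplus m2plus ha α hα0 hα1)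
  have hAb : 0 ≤ max amin aplus := ha.le.trans (le_max_left _ _)
  refine ⟨δ / 2, cH d (max amin aplus) δ c, half_pos hδ, cH_pos d hAb hc, ?_⟩
  intro k hk a m2 h1 h2 h3 h4 M M0 s hs hM f F hF μ x xe x' xe' hxe hxe' hne D Db Df hD hDb hDf
  have hcoef : ∀ (k : ℕ), 1 ≤ k → ∀ a, amin ≤ a → a ≤ aplus →
      0 < (fun a k => B1.aSeq a ((ℓ : ℝ) + 1) k) a k ∧ (fun a k => B1.aSeq a ((ℓ : ℝ) + 1) k) a k ≤ max amin aplus := by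
    intro k hk a h1 h2
    obtain ⟨-, hA2, hA0⟩ := aSeq_window hℓ ha h1 h2 hk
    exact ⟨hA0, hA2.trans (le_max_right _ _)⟩
  have h := delta112_holder_of_bounds hℓ _ hcoef hδ hc hα0 hα1.le H k hk a m2 h1 h2 h3 h4 M M0 s hs hM f F hF
    μ x xe x' xe' hxe hxe' hne D Db Df hD hDb hDf
  simpa only [dfac, mul_assoc] using h

/-- the Hölder clause of (1.9)·(1.12) for `δG` at `A = 0`, nested boxes, with the literal coefficient `a` of (1.6)
(`G_k(·, 0) = (−Δ^{η,N} + m² + aP_k)^{-1}`, `a` itself ranging over the window).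
[cite: Balaban1983RegularityDecay, p. 573 Theorem (Prop. 2.1 of [1]) (1.9), (1.11)–(1.12) with (1.6) p. 572; p. 579] -/
theorem delta112_zero_box_holder_coeff (d ℓ : ℕ) (hℓ : 1 ≤ ℓ) (amin aplus m2plus : ℝ) (ha : 0 < amin) (α : ℝ)
    (hα0 : 0 ≤ α) (hα1 : α < 1) :
    ∃ δ₀ c₀ : ℝ, 0 < δ₀ ∧ 0 < c₀ ∧ ∀ (k : ℕ), 1 ≤ k → ∀ (a m2 : ℝ), amin ≤ a → a ≤ aplus → 0 ≤ m2 →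
      m2 ≤ m2plus → ∀ (M M0 : Fin (d + 1) → ℕ) (s : Fin (d + 1) → ℤ) (hs : Fits M M0 s), (∀ i, 1 ≤ M i) →
      ∀ (f : ↥(boxDom (fun i => (ℓ + 1) ^ k * M i)) → ℝ) (F : ℝ), (∀ z, |f z| ≤ F) →
      ∀ (μ : Fin (d + 1)) (x xe x' xe' : ↥(boxDom (fun i => (ℓ + 1) ^ k * M i))),
        xe.1 = x.1 + Pi.single μ 1 → xe'.1 = x'.1 + Pi.single μ 1 → x'.1 ≠ x.1 →
      ∀ (D Db Df : ℝ),
        (∀ z, f z ≠ 0 → D ≤ min (supNorm (x.1 - z.1)) (supNorm (x'.1 - z.1))) →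
        (∀ y : ↥(boxDom (fun i => (ℓ + 1) ^ k * M0 i)),
          (y.1 - fun i => ((((ℓ + 1) ^ k : ℕ) : ℤ)) * s i) ∉ boxDom (fun i => (ℓ + 1) ^ k * M i) →
            Db ≤ min (supNorm ((emb (hs.scale ((ℓ + 1) ^ k)) x).1 - y.1))
              (supNorm ((emb (hs.scale ((ℓ + 1) ^ k)) x').1 - y.1))) →
        (∀ z, f z ≠ 0 → ∀ y : ↥(boxDom (fun i => (ℓ + 1) ^ k * M0 i)),
          (y.1 - fun i => ((((ℓ + 1) ^ k : ℕ) : ℤ)) * s i) ∉ boxDom (fun i => (ℓ + 1) ^ k * M i) →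
            Df ≤ supNorm ((emb (hs.scale ((ℓ + 1) ^ k)) z).1 - y.1)) →
        ((((ℓ + 1) ^ k : ℕ) : ℝ) / supNorm (x'.1 - x.1)) ^ α *
          |(((ℓ + 1) ^ k : ℕ) : ℝ) * ((dG ((ℓ + 1) ^ k) a m2 hs f xe' - dG ((ℓ + 1) ^ k) a m2 hs f x')
            - (dG ((ℓ + 1) ^ k) a m2 hs f xe - dG ((ℓ + 1) ^ k) a m2 hs f x))|
          ≤ c₀ * Real.exp (-(δ₀ * D / (((ℓ + 1) ^ k : ℕ) : ℝ)))
              * Real.exp (-(δ₀ * Db / (((ℓ + 1) ^ k : ℕ) : ℝ) + δ₀ * Df / (((ℓ + 1) ^ k : ℕ) : ℝ))) * F := by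
  obtain ⟨δ, c, hδ, hc, H⟩ := bounds_common3 (fun a _ => a)
    (thm110_zero_box_roww_coeff d ℓ hℓ amin aplus m2plus ha)
    (thm110_zero_box_deriv_roww_coeff d ℓ hℓ amin aplus m2plus ha)
    (thm19_zero_box_holder_roww_coeff d ℓ hℓ amin aplus m2plus ha α hα0 hα1)
  have hAb : 0 ≤ max amin aplus := ha.le.trans (le_max_left _ _)
  refine ⟨δ / 2, cH d (max amin aplus) δ c, half_pos hδ, cH_pos d hAb hc, ?_⟩
  intro k hk a m2 h1 h2 h3 h4 M M0 s hs hM f F hF μ x xe x' xe' hxe hxe' hne D Db Df hD hDb hDf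
  have hcoef : ∀ (k : ℕ), 1 ≤ k → ∀ a, amin ≤ a → a ≤ aplus →
      0 < (fun a _ => a : ℝ → ℕ → ℝ) a k ∧ (fun a _ => a : ℝ → ℕ → ℝ) a k ≤ max amin aplus :=
    fun k _ a h1 h2 => ⟨lt_of_lt_of_le ha h1, h2.trans (le_max_right _ _)⟩
  have h := delta112_holder_of_bounds hℓ _ hcoef hδ hc hα0 hα1.le H k hk a m2 h1 h2 h3 h4 M M0 s hs hM f F hF
    μ x xe x' xe' hxe hxe' hne D Db Df hD hDb hDf
  simpa only [dfac, mul_assoc] using h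

end Final

/-! ## §6 Non-vacuity: the hypotheses are met

(`d + 1 = 4`, `L = 2`, window `a ∈ [1/2, 2]`, `m² ∈ [0, 1]`, `α = 1/2`; a genuinely nested pair
`Ω = 1 + [0,1)^4 ⊂ Ω₀ = [0,3)^4`; a genuine pair of distinct points with their `μ`-neighbours in a fine box; the
distance hypotheses with `D = D_b = D_f = 0`.) -/

section NonVacuity

/-- the Hölder clause at the physical dimension `d + 1 = 4`, `L = 2`, window `[1/2, 2] × [0, 1]`, `α = 1/2`. -/
example : ∃ δ₀ c₀ : ℝ, 0 < δ₀ ∧ 0 < c₀ ∧ ∀ (k : ℕ), 1 ≤ k → ∀ (a m2 : ℝ), (1 / 2 : ℝ) ≤ a → a ≤ 2 → 0 ≤ m2 →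
      m2 ≤ 1 → ∀ (M M0 : Fin (3 + 1) → ℕ) (s : Fin (3 + 1) → ℤ) (hs : Fits M M0 s), (∀ i, 1 ≤ M i) →
      ∀ (f : ↥(boxDom (fun i => (1 + 1) ^ k * M i)) → ℝ) (F : ℝ), (∀ z, |f z| ≤ F) →
      ∀ (μ : Fin (3 + 1)) (x xe x' xe' : ↥(boxDom (fun i => (1 + 1) ^ k * M i))),
        xe.1 = x.1 + Pi.single μ 1 → xe'.1 = x'.1 + Pi.single μ 1 → x'.1 ≠ x.1 →
      ∀ (D Db Df : ℝ),
        (∀ z, f z ≠ 0 → D ≤ min (supNorm (x.1 - z.1)) (supNorm (x'.1 - z.1))) →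
        (∀ y : ↥(boxDom (fun i => (1 + 1) ^ k * M0 i)),
          (y.1 - fun i => ((((1 + 1) ^ k : ℕ) : ℤ)) * s i) ∉ boxDom (fun i => (1 + 1) ^ k * M i) →
            Db ≤ min (supNorm ((emb (hs.scale ((1 + 1) ^ k)) x).1 - y.1))
              (supNorm ((emb (hs.scale ((1 + 1) ^ k)) x').1 - y.1))) →
        (∀ z, f z ≠ 0 → ∀ y : ↥(boxDom (fun i => (1 + 1) ^ k * M0 i)),
          (y.1 - fun i => ((((1 + 1) ^ k : ℕ) : ℤ)) * s i) ∉ boxDom (fun i => (1 + 1) ^ k * M i) →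
            Df ≤ supNorm ((emb (hs.scale ((1 + 1) ^ k)) z).1 - y.1)) →
        ((((1 + 1) ^ k : ℕ) : ℝ) / supNorm (x'.1 - x.1)) ^ (1 / 2 : ℝ) *
          |(((1 + 1) ^ k : ℕ) : ℝ) *
            ((dG ((1 + 1) ^ k) (B1.aSeq a ((1 : ℕ) + 1 : ℝ) k) m2 hs f xe' - dG ((1 + 1) ^ k) (B1.aSeq a ((1 : ℕ) + 1 : ℝ) k) m2 hs f x')
              - (dG ((1 + 1) ^ k) (B1.aSeq a ((1 : ℕ) + 1 : ℝ) k) m2 hs f xe - dG ((1 + 1) ^ k) (B1.aSeq a ((1 : ℕ) + 1 : ℝ) k) m2 hs f x))|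
          ≤ c₀ * Real.exp (-(δ₀ * D / (((1 + 1) ^ k : ℕ) : ℝ)))
              * Real.exp (-(δ₀ * Db / (((1 + 1) ^ k : ℕ) : ℝ) + δ₀ * Df / (((1 + 1) ^ k : ℕ) : ℝ))) * F :=
  delta112_zero_box_holder 3 1 le_rfl (1 / 2) 2 1 (by norm_num) (1 / 2) (by norm_num) (by norm_num)

/-- the same with the literal coefficient. -/
example : ∃ δ₀ c₀ : ℝ, 0 < δ₀ ∧ 0 < c₀ ∧ ∀ (k : ℕ), 1 ≤ k → ∀ (a m2 : ℝ), (1 / 2 : ℝ) ≤ a → a ≤ 2 → 0 ≤ m2 →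
      m2 ≤ 1 → ∀ (M M0 : Fin (3 + 1) → ℕ) (s : Fin (3 + 1) → ℤ) (hs : Fits M M0 s), (∀ i, 1 ≤ M i) →
      ∀ (f : ↥(boxDom (fun i => (1 + 1) ^ k * M i)) → ℝ) (F : ℝ), (∀ z, |f z| ≤ F) →
      ∀ (μ : Fin (3 + 1)) (x xe x' xe' : ↥(boxDom (fun i => (1 + 1) ^ k * M i))),
        xe.1 = x.1 + Pi.single μ 1 → xe'.1 = x'.1 + Pi.single μ 1 → x'.1 ≠ x.1 →
      ∀ (D Db Df : ℝ),
        (∀ z, f z ≠ 0 → D ≤ min (supNorm (x.1 - z.1)) (supNorm (x'.1 - z.1))) →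
        (∀ y : ↥(boxDom (fun i => (1 + 1) ^ k * M0 i)),
          (y.1 - fun i => ((((1 + 1) ^ k : ℕ) : ℤ)) * s i) ∉ boxDom (fun i => (1 + 1) ^ k * M i) →
            Db ≤ min (supNorm ((emb (hs.scale ((1 + 1) ^ k)) x).1 - y.1))
              (supNorm ((emb (hs.scale ((1 + 1) ^ k)) x').1 - y.1))) →
        (∀ z, f z ≠ 0 → ∀ y : ↥(boxDom (fun i => (1 + 1) ^ k * M0 i)),
          (y.1 - fun i => ((((1 + 1) ^ k : ℕ) : ℤ)) * s i) ∉ boxDom (fun i => (1 + 1) ^ k * M i) →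
            Df ≤ supNorm ((emb (hs.scale ((1 + 1) ^ k)) z).1 - y.1)) →
        ((((1 + 1) ^ k : ℕ) : ℝ) / supNorm (x'.1 - x.1)) ^ (1 / 2 : ℝ) *
          |(((1 + 1) ^ k : ℕ) : ℝ) * ((dG ((1 + 1) ^ k) a m2 hs f xe' - dG ((1 + 1) ^ k) a m2 hs f x')
            - (dG ((1 + 1) ^ k) a m2 hs f xe - dG ((1 + 1) ^ k) a m2 hs f x))|
          ≤ c₀ * Real.exp (-(δ₀ * D / (((1 + 1) ^ k : ℕ) : ℝ)))
              * Real.exp (-(δ₀ * Db / (((1 + 1) ^ k : ℕ) : ℝ) + δ₀ * Df / (((1 + 1) ^ k : ℕ) : ℝ))) * F :=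
  delta112_zero_box_holder_coeff 3 1 le_rfl (1 / 2) 2 1 (by norm_num) (1 / 2) (by norm_num) (by norm_num)

/-- a genuinely nested pair: `Ω = 1 + [0,1)^4 ⊂ Ω₀ = [0,3)^4`, `M_μ = 1 ≥ 1`. -/
example : Fits (fun _ : Fin (3 + 1) => 1) (fun _ => 3) (fun _ => 1) ∧ ∀ i, 1 ≤ (fun _ : Fin (3 + 1) => 1) i :=
  ⟨fun _ => ⟨by norm_num, by norm_num⟩, fun _ => le_rfl⟩

/-- a genuine quadruple of points in the fine box `[0,2)^4` (scale `k = 1`, `L = 2`, `M = 1`): `x = 0`, `x′ = e₁`,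
and their `e₀`-neighbours; `x′ ≠ x`. -/
example : ((fun _ => 0 : Fin (3 + 1) → ℤ) ∈ boxDom (fun i : Fin (3 + 1) => (1 + 1) ^ 1 * (fun _ => 1) i)) ∧
    ((fun _ => 0 : Fin (3 + 1) → ℤ) + Pi.single 0 1 ∈ boxDom (fun i : Fin (3 + 1) => (1 + 1) ^ 1 * (fun _ => 1) i)) ∧
    ((Pi.single 1 1 : Fin (3 + 1) → ℤ) ∈ boxDom (fun i : Fin (3 + 1) => (1 + 1) ^ 1 * (fun _ => 1) i)) ∧
    ((Pi.single 1 1 : Fin (3 + 1) → ℤ) + Pi.single 0 1 ∈ boxDom (fun i : Fin (3 + 1) => (1 + 1) ^ 1 * (fun _ => 1) i)) ∧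
    (Pi.single 1 1 : Fin (3 + 1) → ℤ) ≠ (fun _ => 0) := by
  refine ⟨?_, ?_, ?_, ?_, ?_⟩
  · rw [mem_boxDom]; intro i; simp
  · rw [mem_boxDom]; intro i; fin_cases i <;> simp
  · rw [mem_boxDom]; intro i; fin_cases i <;> simp
  · rw [mem_boxDom]; intro i; fin_cases i <;> simp
  · intro h
    have := congr_fun h 1
    simp at this

/-- the distance hypotheses are always met by `D = D_b = D_f = 0`. -/
example {n : ℕ} {M M0 : Fin (d + 1) → ℕ} {s : Fin (d + 1) → ℤ} (hs : Fits M M0 s)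
    (f : ↥(boxDom (fun i => n * M i)) → ℝ) (x x' : ↥(boxDom (fun i => n * M i))) :
    (∀ z, f z ≠ 0 → (0 : ℝ) ≤ min (supNorm (x.1 - z.1)) (supNorm (x'.1 - z.1))) ∧
    (∀ y : ↥(boxDom (fun i => n * M0 i)),
      (y.1 - fun i => (n : ℤ) * s i) ∉ boxDom (fun i => n * M i) →
        (0 : ℝ) ≤ min (supNorm ((emb (hs.scale n) x).1 - y.1)) (supNorm ((emb (hs.scale n) x').1 - y.1))) ∧
    (∀ z : ↥(boxDom (fun i => n * M i)), f z ≠ 0 → ∀ y : ↥(boxDom (fun i => n * M0 i)),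
      (y.1 - fun i => (n : ℤ) * s i) ∉ boxDom (fun i => n * M i) →
        (0 : ℝ) ≤ supNorm ((emb (hs.scale n) z).1 - y.1)) :=
  ⟨fun _ _ => le_min (supNorm_nonneg _) (supNorm_nonneg _),
    fun _ _ => le_min (supNorm_nonneg _) (supNorm_nonneg _), fun _ _ _ _ => supNorm_nonneg _⟩

end NonVacuity

end

end Literature.MathematicalPhysics.QuantumFieldTheory.Balaban1983to89.B4Delta112ZeroBoxHolder
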